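import Summits.NavierStokesRegularity.NavierStokesRegularity.Theses.CorkscrewDynamo
import Summits.NavierStokesRegularity.NavierStokesRegularity.Theses.FilamentSkeletonRss
import Summits.NavierStokesRegularity.NavierStokesRegularity.Theses.QuarterTurnRdss
import Summits.NavierStokesRegularity.NavierStokesRegularity.Theorems.TypeIDSSLiouvilleConjecture
import Summits.NavierStokesRegularity.NavierStokesRegularity.Theorems.CorkscrewDynamoCorkscrewProfileRelativeEquilibriumReduction
import Summits.NavierStokesRegularity.NavierStokesRegularity.Theorems.CorkscrewDynamoCorkscrewProfileRelativeEquilibriumConstraints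
import Summits.NavierStokesRegularity.NavierStokesRegularity.Theorems.CorkscrewDynamoCorkscrewProfileRelativeEquilibriumRigidity
import Summits.NavierStokesRegularity.NavierStokesRegularity.Theorems.CorkscrewDynamoCorkscrewProfileRelativeEquilibriumBridges
import Summits.NavierStokesRegularity.NavierStokesRegularity.Theorems.CorkscrewDynamoCorkscrewProfileOfRssProfileExists
import Summits.NavierStokesRegularity.NavierStokesRegularity.Theorems.CorkscrewDynamoCorkscrewProfileOfQuarterTurnProfileExists
import Summits.NavierStokesRegularity.NavierStokesRegularity.Theorems.CorkscrewProfile.Negative.CorkscrewProfileFalseOfTypeIDSSLiouvilleConjecture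
import Summits.NavierStokesRegularity.NavierStokesRegularity.Theorems.CorkscrewDynamoCorkscrewProfileSharpRepresentative
import Summits.NavierStokesRegularity.NavierStokesRegularity.Theorems.CorkscrewDynamoCorkscrewProfileAngleTools
import Summits.NavierStokesRegularity.NavierStokesRegularity.Theorems.CorkscrewDynamoCorkscrewProfileNormalForm
import Summits.NavierStokesRegularity.NavierStokesRegularity.Theorems.CorkscrewDynamoCorkscrewProfileNearIdentityRigidity
import Summits.NavierStokesRegularity.NavierStokesRegularity.Theorems.CorkscrewDynamoCorkscrewProfileRssWindow
import Summits.NavierStokesRegularity.NavierStokesRegularity.Theorems.CorkscrewDynamoCorkscrewProfileRssIffNearIdentity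
import Summits.NavierStokesRegularity.NavierStokesRegularity.Theorems.CorkscrewDynamoCorkscrewProfileRssCoRotation
import Summits.NavierStokesRegularity.NavierStokesRegularity.Theorems.FilamentSkeletonRssRdssProfileTruncation
import Summits.NavierStokesRegularity.NavierStokesRegularity.Theorems.CorkscrewDynamoCorkscrewProfileCorotatingFrame
import Summits.NavierStokesRegularity.NavierStokesRegularity.Theorems.CorkscrewDynamoCorkscrewProfileRotatedVorticityEq
import Summits.NavierStokesRegularity.NavierStokesRegularity.Theorems.CorkscrewDynamoCorkscrewProfileVerticalVorticityDivergenceForm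
import Summits.NavierStokesRegularity.NavierStokesRegularity.Theorems.CorkscrewDynamoCorkscrewProfileTypeIDerivativeDecay
import Summits.NavierStokesRegularity.NavierStokesRegularity.Theorems.CorkscrewDynamoCorkscrewProfileVerticalVorticityFluxIntegrable
import Summits.NavierStokesRegularity.NavierStokesRegularity.Theorems.CorkscrewDynamoCorkscrewProfileStrictCoRotation
import Summits.NavierStokesRegularity.NavierStokesRegularity.Theorems.CorkscrewDynamoCorkscrewProfileGaussianDivergenceIBP
import Summits.NavierStokesRegularity.NavierStokesRegularity.Theorems.CorkscrewDynamoCorkscrewProfileGaussianPolyIntegrable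
import Summits.NavierStokesRegularity.NavierStokesRegularity.Theorems.CorkscrewDynamoCorkscrewProfileGaussianAngularMomentum
import Summits.NavierStokesRegularity.NavierStokesRegularity.Theorems.CorkscrewDynamoCorkscrewProfileStretchingNecessity
import HarnessLib.Audit

/-!
# Birth skeleton (BC3) of the crux `CorkscrewDynamo.CorkscrewProfile` — v18 (lead c7, 2026-08-17; v16 text of lead c6 and v9 text of lead c4 kept below)

v18: S1–S4 LANDED (p173219, p173450, p173670, p173764) and the lead's assembly `…Theorems/CorkscrewDynamoCorkscrewProfileStretchingNecessity.lean`
LANDED (p173937: `typeI_vorticity_eq_zero_of_subcritical_stretching`, `typeI_eq_zero_of_subcritical_stretching`,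
`exists_supercritical_stretching_of_ne_zero`, `supercritical_stretching_core`, `typeIAncientMild_supercritical_stretching`,
`corkscrewProfile_supercritical_stretching`, `exists_supercritical_stretching_steady`, `rssProfileExists_supercritical_stretching`,
`not_rssProfileExists_of_stretching_liouville`) — all cited below by name; the skeleton is back to ONE sorry = the open item stmt-16274.

v17 (lead c7): same single OPEN stub `stub_rssProfileExists` (= stmt-16274, by name) and the same composition; registers the
STRETCHING-NECESSITY block (section `StretchingNecessity`, after `RotationGaugedHead`): worker tool stubs
S1 `stub_subcriticalStretchingSteady` (elliptic: an RSS / rotated Leray profile with `⟪ω, DU ω⟫ ≤ |ω|²` everywhere is trivial),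
S2 `stub_vorticitySqTransport` (the transport identity of `|ω|²` for classical solutions on `(−∞,0)`),
S3 `stub_ancientSubsolutionNonpos` (ancient subsolutions of the drift–heat equation with Type-I drift, bounded by `b(t) → 0`
as `t → −∞`, are `≤ 0`: weak maximum principle + barrier), S4 `stub_typeIGradientBound` (PV 2026 Lemma 7.1, `n = 1`), and the
lead's assemblies `typeI_vorticity_eq_zero_of_subcritical_stretching` (classical Type-I ancient solutions with
`(−t)⟪ω, ∇u ω⟫ ≤ Λ|ω|²`, `Λ < 1`, are trivial), its corollaries for corkscrews (`corkscrewProfile_supercritical_stretching`) and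
for the witnesses of stmt-16274 (`rssProfileExists_supercritical_stretching`) — all LANDED at v18 (p173219, p173450, p173670, p173764,
p173937) and cited by name; all `--supports` the crux, none in the composition.

v13/v14 (lead c6): same single OPEN stub `stub_rssProfileExists` (= stmt-16274, by name) and the same composition; registers the
STRICT CO-ROTATION block (section `RotationGaugedHead`, after T11): worker tool stubs V1 `stub_rotatedVorticityEq`,
V2 `stub_verticalVorticityDivergenceForm`, V3 `stub_verticalVorticityFluxIntegrable`, V4 `stub_typeIDerivativeDecay`, and the
lead's assemblies A1 `rotatedLerayProfile_eq_zero_of_cyclonic`, A2 `rotatedLerayProfile_eq_zero_of_offBall`,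
A3 `rssProfileExists_enters_corotationBall` (sorried until landed; all `--supports` the crux, none in the composition).
v14: V1–V4 LANDED (p170716, p170767, p170889, p170693) and cited; wave 2 registers W1 `stub_gaussianDivergenceIBP`,
W2 `stub_gaussianPolyIntegrable` and the lead's W3 `gaussian_angularMomentum_eq_lambTorque` (Gaussian angular-momentum identity).
v15: A1–A3 LANDED p171291 (`…StrictCoRotation.lean`), W1 p171087, W2 p171103 LANDED — all cited; sorries = the open stub + W3 (wave 3 running).
v16: W3 LANDED p171631 (+ tools p171411) and cited — the skeleton is back to ONE sorry = the open item stmt-16274; lead c6 outcome blocked-on stmt-16274.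

(crux item `stmt-NavierStokesRegularity-11282`, rank 2, route `route-NavierStokesRegularity-CorkscrewDynamo`;
tree path `Cruxes/CorkscrewProfile/Lines/birth.lean` (payload slug `registered`); registrar
`planner-skel-stmt-NavierStokesRegularity-11282-0`, reshaped by the line leads `…-11282-c1-0` (v1–v3), `…-11282-c2-0` (v4) and
`…-11282-c3-0` (v5: same single open stub and composition; adds the crux-level normal form, the small-constant exclusion and the
irrational-angle bridge, all landed — see the c3 block below) and `…-11282-c4-0` (v6: same single open stub and composition; adds
five TOOL STUBS `stub_rdssIterate`, `stub_rdssWitness`, `stub_angleTuning`, `stub_rdssTunedCompactness`,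
`stub_nearIdentityRigidity` proving the NEAR-IDENTITY RIGIDITY of the crux's witness set — see the block before `end`; v7: all five
LANDED — p160957, p161497, p161926, p162300, p162589 — and are cited by name; v7 also registers ONE more tool stub F6
`stub_rssWindow` (PV 2026 Thm 1.4 in the Oseen gauge: the speed window of the RSS field); v8: F6 LANDED p163469 (worker) and is
cited; v8 registers the last tool stub F7 `stub_rssIffNearIdentity` (the open stub stmt-16274 ⟺ near-identity accumulation of
nontrivial Type-I RDSS solutions about `e₃` at a bounded constant); v9: F7 LANDED (p164031) and is cited — the skeleton is back to
ONE sorry = the open item stmt-16274, with SEVEN landed tool stubs of this lead cited by name.)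

THE CUT — the corkscrew as a ROTATED SELF-SIMILAR (RSS) PROFILE. `CorkscrewProfile` asks for a nontrivial Type-I
ancient mild solution on `ℝ³ × (−∞,0)`, rotated `c`-DSS about `e₃` for one `c > 1`, with the rotation ESSENTIAL.
The line's object is a profile turning at constant angular velocity `α ≠ 0` — a relative equilibrium of Leray's
backward system (v1–v3: a smooth solution `(V, Q)` of (RE_ω) in the Type-I envelope, `stub_relativeEquilibrium`).
Lead c2 proved that this is ONE object shared with two sibling routes, and v4 states the single open stub in its
weakest registered form, BY NAME:

  `stub_rssProfileExists : FilamentSkeletonRss.RssProfileExists`      (= item stmt-NavierStokesRegularity-16274,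
                                                                        the TARGET of route FilamentSkeletonRss)

and the composition is the landed tree theorem
`Theorems.CorkscrewProfile.Birth.corkscrewProfile_of_rssProfileExists : RssProfileExists → CorkscrewProfile`
(p155081: KNSS 2009 Thm 5.3 excludes an axisymmetric profile through the time-shifted bounded field; a
non-axisymmetric pattern turning at rate `α ≠ 0` is essentially rotating for the factor `c = e^{−ψ/(2α)}`).

WHAT IS IN THE TREE (all sorry-free, axioms propext / Classical.choice / Quot.sound):
* v1–v3 (lead c1): `stub_corotatingFrame` (p148726), the glue `corkscrewProfile_of_relativeEquilibrium` (p150491),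
  necessary conditions `stub_rotationWindow`, `stub_noSphereTangentEquilibrium`, `relativeEquilibrium_eq_zero_of_nonpos`
  (p150960);
* v4 (lead c2): RIGIDITY `relativeEquilibrium_iff_rotatedLerayProfile` — the v3 stub body ↔ "∃ α ≠ 0 and a smooth
  nontrivial solution `(U, P)` of Perelman's rotated Leray profile system with `‖U‖ ≤ C₀/(1+‖y‖)`, `P` bounded"
  (its side clauses are idle: `relativeEquilibrium_eq_zero_of_omega_zero`, `…_of_axisymmetric`, `…_of_small`), p154163;
  BRIDGES `rssProfileExists_of_relativeEquilibrium` (v3 stub ⇒ stmt-16274) and `corkscrewProfile_of_rotatedLerayProfile`,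
  p155162; `corkscrewProfile_of_rssProfileExists` (stmt-16274 ⇒ crux), p155081;
  `corkscrewProfile_of_quarterTurnProfileExists` (QuarterTurnRdss crux stmt-1100 ⇒ crux), p155310; the negative record
  `CorkscrewProfile_false_of_TypeIDSSLiouvilleConjecture` (wall ⇒ ¬crux), p154227.
So: v3 stub ⇒ stmt-16274 ⇒ crux, and stmt-1100 ⇒ crux; the crux is refuted by the wall `TypeIDSSLiouvilleConjecture`.

v5 (lead c3) — FACTS ABOUT THE CRUX ITSELF (all landed, sorry-free, axioms propext / Classical.choice / Quot.sound):
* `stub_sharpRepresentative` (p157396, `Theorems/CorkscrewDynamoCorkscrewProfileSharpRepresentative.lean`): a Type-I rotated-DSS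
  ancient mild solution in the duality form has an Oseen-gauge representative `V` (`IsTypeIAncientMild C₀ V`) with the SAME
  `(c, R)`, the SAME constant `C₀`, and `V t = u t` a.e. for EVERY `t < 0` (sharpening of `stub_rdssSmoothRepresentative`).
* `stub_corkscrewAngleTools` (p157725, `…AngleTools.lean`): `ℤθ + 2πℤ` is dense for `θ/2π` irrational, so ONE irrational
  rotation of equivariance makes a continuous field axisymmetric; an Oseen-gauge Type-I field with axisymmetric slices vanishes
  (KNSS Thm 5.3, `typeIAncientMild_eq_zero_of_isAxisymmetric`).
* `stub_corkscrewNormalForm` (p157946, `…NormalForm.lean`): `corkscrewProfile_iff_smooth` — the crux ⇔ a corkscrew in the Oseen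
  gauge with the essential-rotation clause POINTWISE (no measure theory); `corkscrew_constant_lower_bound` — an absolute `ε > 0`
  below which no Type-I constant carries a corkscrew (Chae–Wolf Rmk 1.4 analogue asked for by the planner);
  `corkscrewProfile_of_not_rotatedTypeIDSSLiouville` — for `c > 1` and `θ/2π` IRRATIONAL, the failure of the single wall
  instance `RotatedTypeIDSSLiouville c (rotZLIE θ)` already gives the crux (rotation is automatically essential: a.e.
  `R_θ`-equivariant slices ⇒ axisymmetric representative ⇒ zero); conversely `exists_not_rotatedTypeIDSSLiouville_of_corkscrewProfile`
  (`cos θ ≠ 1`); and `exists_irrational_not_rotatedTypeIDSSLiouville_of_rssProfileExists` — the open stub implies that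
  hypothesis (factor `c = e^s`, `α s = ±√2 π`). NET LOGICAL POSITION OF THE CRUX IN THE TREE:
    `RssProfileExists (stmt-16274)` ⟹ `∃ c>1, θ∉2πℚ, ¬RotatedTypeIDSSLiouville c (rotZLIE θ)` ⟹ `CorkscrewProfile`
    ⟹ `∃ c>1, cos θ ≠ 1, ¬RotatedTypeIDSSLiouville c (rotZLIE θ)` ⟹ `¬TypeIDSSLiouvilleConjecture`;
  i.e. up to the rational non-integer angles the crux IS the negative side of the rotated half of Tsai's wall, and any
  Type-I RDSS existence theorem at an irrational angle, from any route, closes it.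

THE OPEN STUB is the existence of a Type-I rotated self-similar profile with `α ≠ 0`: the NEGATIVE side of
Pineau–Vicol 2026 Conjecture 1.1 (= Tsai 2018 Conj. 8.9 = Bradshaw–Tsai 2017 OP 5.1, RSS case). Known constraints
(tree theorems): `α = 0` excluded (Tsai 1998); `|α|` small or large excluded for each `C₀` (PV Thm 1.4, in tree);
axisymmetric excluded (KNSS); `C₀ ≤ ε₀` excluded uniformly (Chae–Wolf Step 1); sphere-tangent excluded. It is held by
route FilamentSkeletonRss as its target; this line is CLOSED MODULO that item.

Barriers: `AxisymmetricTypeIExclusion` — now a theorem about the stub (`rssProfile_eq_zero_of_axisymmetric`), not a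
clause; `LeraySelfSimilarBlowupExclusion` — `α = 0` excluded; Chae–Wolf/PV windows as above. Disproof used: none filed
(no `Disproof.lean` for this crux, 2026-08-17); Negative/: the wall record above.
-/

noncomputable section

open Summit.NavierStokesRegularity.NavierStokesRegularity.Theorems.CorkscrewProfile.Birth

namespace Summit.NavierStokesRegularity.NavierStokesRegularity.Cruxes.CorkscrewProfile.Birth

set_option linter.dupNamespace false

/-- **stub 1 (v4) — `stub_rssProfileExists` (XL, OPEN; the analytic core, BY NAME the target of route
`FilamentSkeletonRss`, item stmt-NavierStokesRegularity-16274).** There are `α ≠ 0`, `C₀`, a nontrivial `C²`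
slice `U`, a family of linear isometries `Rot θ` pinned on the standard basis to the rotations about `e₃`, and an
ancient mild solution `u` (`ν = 1`) on `ℝ³ × (−∞,0)` with measurable slices and Type-I decay `C₀`, `u(−1) = U`,
rotated discretely self-similar for EVERY factor `c > 0` with the rotation `Rot (−2α log c)` — i.e.
`u(t,x) = (−t)^{−1/2} R(αs) U(R(−αs) x/√(−t))`, `s = −log(−t)`: a Type-I RSS profile turning at rate `α`
(¬ Pineau–Vicol 2026 Conj. 1.1 / Tsai Conj. 8.9). Implied by the v3 stub (`rssProfileExists_of_relativeEquilibrium`); implies the irrational-angle hypothesis of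
`corkscrewProfile_of_not_rotatedTypeIDSSLiouville` (v5). -/
theorem stub_rssProfileExists :
    Summit.NavierStokesRegularity.NavierStokesRegularity.Theses.FilamentSkeletonRss.RssProfileExists := by
  sorry

/-- **Birth composition (the skeleton theorem, v4).** The crux BY NAME from the registered open stub, used by name,
through the LANDED bridge `Theorems.CorkscrewProfile.Birth.corkscrewProfile_of_rssProfileExists` (p155081). -/
theorem CorkscrewProfile_of :
    Summit.NavierStokesRegularity.NavierStokesRegularity.Theses.CorkscrewDynamo.CorkscrewProfile :=
  corkscrewProfile_of_rssProfileExists stub_rssProfileExists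

/-! ### Landed sufficient conditions, bridges and the negative record (citations; not part of the composition) -/

/-- The v1–v3 stub (a non-`R_{ωL}`-invariant relative equilibrium of Leray's backward system in the Type-I envelope)
implies the v4 stub (landed `rssProfileExists_of_relativeEquilibrium`, p155162) … -/
example :
    (∃ (Rot : ℝ → (EuclideanSpace ℝ (Fin 3) ≃ₗᵢ[ℝ] EuclideanSpace ℝ (Fin 3))) (ω L C : ℝ)
      (V : EuclideanSpace ℝ (Fin 3) → EuclideanSpace ℝ (Fin 3)) (Q : EuclideanSpace ℝ (Fin 3) → ℝ),
      (∀ (φ : ℝ) (x : EuclideanSpace ℝ (Fin 3)),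
          Rot φ x 0 = Real.cos φ * x 0 - Real.sin φ * x 1 ∧
          Rot φ x 1 = Real.sin φ * x 0 + Real.cos φ * x 1 ∧ Rot φ x 2 = x 2) ∧
      0 < L ∧ ContDiff ℝ (⊤ : ℕ∞) V ∧ ContDiff ℝ (⊤ : ℕ∞) Q ∧
      Literature.Analysis.FluidPDE.VectorCalculus.IsDivFree V ∧
      (∀ y : EuclideanSpace ℝ (Fin 3),
          ω • (Literature.Analysis.FluidPDE.cross (EuclideanSpace.single (2 : Fin 3) (1 : ℝ)) (V y)
                - fderiv ℝ V y (Literature.Analysis.FluidPDE.cross (EuclideanSpace.single (2 : Fin 3) (1 : ℝ)) y))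
            + (1 / 2 : ℝ) • V y + (1 / 2 : ℝ) • fderiv ℝ V y y
            + Literature.Analysis.FluidPDE.convect V V y + gradient Q y
            = Laplacian.laplacian V y) ∧
      (∀ y : EuclideanSpace ℝ (Fin 3), (1 + ‖y‖) * ‖V y‖ ≤ C) ∧
      (∀ y : EuclideanSpace ℝ (Fin 3), |Q y| ≤ C) ∧
      (∃ y : EuclideanSpace ℝ (Fin 3), Rot (ω * L) (V (Rot (-(ω * L)) y)) ≠ V y)) →
    Summit.NavierStokesRegularity.NavierStokesRegularity.Theses.FilamentSkeletonRss.RssProfileExists :=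
  rssProfileExists_of_relativeEquilibrium

/-- … and the crux directly (landed v3 composition `corkscrewProfile_of_relativeEquilibrium`, p150491). -/
example :
    (∃ (Rot : ℝ → (EuclideanSpace ℝ (Fin 3) ≃ₗᵢ[ℝ] EuclideanSpace ℝ (Fin 3))) (ω L C : ℝ)
      (V : EuclideanSpace ℝ (Fin 3) → EuclideanSpace ℝ (Fin 3)) (Q : EuclideanSpace ℝ (Fin 3) → ℝ),
      (∀ (φ : ℝ) (x : EuclideanSpace ℝ (Fin 3)),
          Rot φ x 0 = Real.cos φ * x 0 - Real.sin φ * x 1 ∧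
          Rot φ x 1 = Real.sin φ * x 0 + Real.cos φ * x 1 ∧ Rot φ x 2 = x 2) ∧
      0 < L ∧ ContDiff ℝ (⊤ : ℕ∞) V ∧ ContDiff ℝ (⊤ : ℕ∞) Q ∧
      Literature.Analysis.FluidPDE.VectorCalculus.IsDivFree V ∧
      (∀ y : EuclideanSpace ℝ (Fin 3),
          ω • (Literature.Analysis.FluidPDE.cross (EuclideanSpace.single (2 : Fin 3) (1 : ℝ)) (V y)
                - fderiv ℝ V y (Literature.Analysis.FluidPDE.cross (EuclideanSpace.single (2 : Fin 3) (1 : ℝ)) y))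
            + (1 / 2 : ℝ) • V y + (1 / 2 : ℝ) • fderiv ℝ V y y
            + Literature.Analysis.FluidPDE.convect V V y + gradient Q y
            = Laplacian.laplacian V y) ∧
      (∀ y : EuclideanSpace ℝ (Fin 3), (1 + ‖y‖) * ‖V y‖ ≤ C) ∧
      (∀ y : EuclideanSpace ℝ (Fin 3), |Q y| ≤ C) ∧
      (∃ y : EuclideanSpace ℝ (Fin 3), Rot (ω * L) (V (Rot (-(ω * L)) y)) ≠ V y)) →
    Summit.NavierStokesRegularity.NavierStokesRegularity.Theses.CorkscrewDynamo.CorkscrewProfile :=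
  corkscrewProfile_of_relativeEquilibrium

/-- One smooth nontrivial solution of Perelman's rotated Leray profile system (`α ≠ 0`, Type-I profile decay, bounded
pressure) is a corkscrew (landed `corkscrewProfile_of_rotatedLerayProfile`, p155162). -/
example :
    (∃ (α C₀ M : ℝ) (U : EuclideanSpace ℝ (Fin 3) → EuclideanSpace ℝ (Fin 3))
      (P : EuclideanSpace ℝ (Fin 3) → ℝ), α ≠ 0 ∧ U ≠ 0 ∧ ContDiff ℝ (⊤ : ℕ∞) U ∧ ContDiff ℝ (⊤ : ℕ∞) P ∧
      Literature.Analysis.FluidPDE.VectorCalculus.IsDivFree U ∧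
      (∀ y : EuclideanSpace ℝ (Fin 3),
        α • (Literature.Analysis.FluidPDE.rotGen (U y) - fderiv ℝ U y (Literature.Analysis.FluidPDE.rotGen y))
          + (1 / 2 : ℝ) • U y + (1 / 2 : ℝ) • fderiv ℝ U y y - Laplacian.laplacian U y
          + fderiv ℝ U y (U y) + gradient P y = 0) ∧
      (∀ y : EuclideanSpace ℝ (Fin 3), ‖U y‖ ≤ C₀ / (1 + ‖y‖)) ∧
      (∀ y : EuclideanSpace ℝ (Fin 3), |P y| ≤ M)) →
    Summit.NavierStokesRegularity.NavierStokesRegularity.Theses.CorkscrewDynamo.CorkscrewProfile :=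
  corkscrewProfile_of_rotatedLerayProfile

/-- A genuinely twisted quarter-turn Type-I RDSS profile (crux `QuarterTurnProfileExists` of route `QuarterTurnRdss`,
stmt-1100) is a corkscrew (landed `corkscrewProfile_of_quarterTurnProfileExists`, p155310). -/
example :
    Summit.NavierStokesRegularity.NavierStokesRegularity.Theses.QuarterTurnRdss.QuarterTurnProfileExists →
      Summit.NavierStokesRegularity.NavierStokesRegularity.Theses.CorkscrewDynamo.CorkscrewProfile :=
  corkscrewProfile_of_quarterTurnProfileExists

/-- The crux is refuted by the Type-I DSS Liouville wall (landed negative record, p154227). -/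
example :
    Summit.NavierStokesRegularity.NavierStokesRegularity.TypeIDSSLiouvilleConjecture →
      ¬ Summit.NavierStokesRegularity.NavierStokesRegularity.Theses.CorkscrewDynamo.CorkscrewProfile :=
  Summit.NavierStokesRegularity.NavierStokesRegularity.Theorems.CorkscrewProfile.Negative.CorkscrewProfile_false_of_TypeIDSSLiouvilleConjecture

/-! ### Landed facts about the crux itself (lead c3; citations) -/

/-- The pointwise normal form of the crux (landed `corkscrewProfile_iff_smooth`, p157946). -/
example :
    Summit.NavierStokesRegularity.NavierStokesRegularity.Theses.CorkscrewDynamo.CorkscrewProfile ↔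
      ∃ (c θ C₀ : ℝ) (V : ℝ → EuclideanSpace ℝ (Fin 3) → EuclideanSpace ℝ (Fin 3)), 1 < c ∧
        Literature.Analysis.FluidPDE.IsTypeIAncientMild C₀ V ∧
        Literature.Analysis.FluidPDE.IsRotatedDSS c (Literature.Analysis.FluidPDE.rotZLIE θ) V ∧
        Literature.Analysis.FluidPDE.HasTypeIDecay C₀ V ∧
        ∃ t < 0, ∃ x, Literature.Analysis.FluidPDE.rotZ θ (V t (Literature.Analysis.FluidPDE.rotZ (-θ) x)) ≠ V t x :=
  corkscrewProfile_iff_smooth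

/-- The irrational-angle bridge: one failed instance of the rotated wall at an irrational angle is a corkscrew
(landed `corkscrewProfile_of_not_rotatedTypeIDSSLiouville`, p157946). -/
example {c θ : ℝ} (hc : 1 < c) (hθ : Irrational (θ / (2 * Real.pi)))
    (h : ¬ Literature.Analysis.FluidPDE.RotatedTypeIDSSLiouville c (Literature.Analysis.FluidPDE.rotZLIE θ)) :
    Summit.NavierStokesRegularity.NavierStokesRegularity.Theses.CorkscrewDynamo.CorkscrewProfile :=
  corkscrewProfile_of_not_rotatedTypeIDSSLiouville hc hθ h

/-- … and the open stub supplies such an instance (landed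
`exists_irrational_not_rotatedTypeIDSSLiouville_of_rssProfileExists`, p157946). -/
example (h : Summit.NavierStokesRegularity.NavierStokesRegularity.Theses.FilamentSkeletonRss.RssProfileExists) :
    ∃ c θ : ℝ, 1 < c ∧ Irrational (θ / (2 * Real.pi)) ∧
      ¬ Literature.Analysis.FluidPDE.RotatedTypeIDSSLiouville c (Literature.Analysis.FluidPDE.rotZLIE θ) :=
  exists_irrational_not_rotatedTypeIDSSLiouville_of_rssProfileExists h

/-- Conversely a corkscrew refutes one instance of the rotated wall at a non-integer angle (landed
`exists_not_rotatedTypeIDSSLiouville_of_corkscrewProfile`, p157946). -/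
example (h : Summit.NavierStokesRegularity.NavierStokesRegularity.Theses.CorkscrewDynamo.CorkscrewProfile) :
    ∃ c θ : ℝ, 1 < c ∧ Real.cos θ ≠ 1 ∧
      ¬ Literature.Analysis.FluidPDE.RotatedTypeIDSSLiouville c (Literature.Analysis.FluidPDE.rotZLIE θ) :=
  exists_not_rotatedTypeIDSSLiouville_of_corkscrewProfile h

/-- Small-constant exclusion: no nontrivial Type-I RDSS ancient mild solution (in particular no corkscrew) has Type-I
constant `≤ ε` (landed `corkscrew_constant_lower_bound`, p157946). -/
example : ∃ ε : ℝ, 0 < ε ∧ ∀ (c : ℝ) (R : EuclideanSpace ℝ (Fin 3) ≃ₗᵢ[ℝ] EuclideanSpace ℝ (Fin 3))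
      (u : ℝ → EuclideanSpace ℝ (Fin 3) → EuclideanSpace ℝ (Fin 3)) (C₀ : ℝ), 0 < c →
      Literature.Analysis.FluidPDE.IsAncientMildSolution 1 u → (∀ t < 0, MeasureTheory.AEStronglyMeasurable (u t) MeasureTheory.volume) →
      Literature.Analysis.FluidPDE.IsRotatedDSS c R u → Literature.Analysis.FluidPDE.HasTypeIDecay C₀ u →
      ¬ (∀ t < 0, u t =ᵐ[MeasureTheory.volume] 0) → ε < C₀ :=
  corkscrew_constant_lower_bound

/-! ### Landed necessary conditions on a relative equilibrium (citations) -/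

/-- `ω = 0` carries no relative equilibrium (landed `relativeEquilibrium_eq_zero_of_omega_zero`, p154163). -/
example (Rot : ℝ → (EuclideanSpace ℝ (Fin 3) ≃ₗᵢ[ℝ] EuclideanSpace ℝ (Fin 3)))
    (V : EuclideanSpace ℝ (Fin 3) → EuclideanSpace ℝ (Fin 3)) (Q : EuclideanSpace ℝ (Fin 3) → ℝ) {C : ℝ}
    (hRot : ∀ (φ : ℝ) (x : EuclideanSpace ℝ (Fin 3)),
        Rot φ x 0 = Real.cos φ * x 0 - Real.sin φ * x 1 ∧
        Rot φ x 1 = Real.sin φ * x 0 + Real.cos φ * x 1 ∧ Rot φ x 2 = x 2)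
    (hV : ContDiff ℝ (⊤ : ℕ∞) V) (hQ : ContDiff ℝ (⊤ : ℕ∞) Q)
    (hdiv : Literature.Analysis.FluidPDE.VectorCalculus.IsDivFree V)
    (hEq : ∀ y : EuclideanSpace ℝ (Fin 3),
        (0 : ℝ) • (Literature.Analysis.FluidPDE.cross (EuclideanSpace.single (2 : Fin 3) (1 : ℝ)) (V y)
              - fderiv ℝ V y (Literature.Analysis.FluidPDE.cross (EuclideanSpace.single (2 : Fin 3) (1 : ℝ)) y))
          + (1 / 2 : ℝ) • V y + (1 / 2 : ℝ) • fderiv ℝ V y y + Literature.Analysis.FluidPDE.convect V V y + gradient Q y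
          = Laplacian.laplacian V y)
    (hVb : ∀ y : EuclideanSpace ℝ (Fin 3), (1 + ‖y‖) * ‖V y‖ ≤ C) : V = 0 :=
  relativeEquilibrium_eq_zero_of_omega_zero Rot V Q hRot hV hQ hdiv hEq hVb

/-- The rotation window (landed `stub_rotationWindow`, p150960). -/
example : ∀ C : ℝ, 0 < C → ∃ α₁ α₂ : ℝ, 0 < α₁ ∧ 0 < α₂ ∧
      ∀ (Rot : ℝ → (EuclideanSpace ℝ (Fin 3) ≃ₗᵢ[ℝ] EuclideanSpace ℝ (Fin 3))) (ω L : ℝ)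
        (V : EuclideanSpace ℝ (Fin 3) → EuclideanSpace ℝ (Fin 3)) (Q : EuclideanSpace ℝ (Fin 3) → ℝ),
        (∀ (φ : ℝ) (x : EuclideanSpace ℝ (Fin 3)),
            Rot φ x 0 = Real.cos φ * x 0 - Real.sin φ * x 1 ∧
            Rot φ x 1 = Real.sin φ * x 0 + Real.cos φ * x 1 ∧ Rot φ x 2 = x 2) →
        ContDiff ℝ (⊤ : ℕ∞) V → ContDiff ℝ (⊤ : ℕ∞) Q →
        Literature.Analysis.FluidPDE.VectorCalculus.IsDivFree V →
        (∀ y : EuclideanSpace ℝ (Fin 3),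
            ω • (Literature.Analysis.FluidPDE.cross (EuclideanSpace.single (2 : Fin 3) (1 : ℝ)) (V y)
                  - fderiv ℝ V y (Literature.Analysis.FluidPDE.cross (EuclideanSpace.single (2 : Fin 3) (1 : ℝ)) y))
              + (1 / 2 : ℝ) • V y + (1 / 2 : ℝ) • fderiv ℝ V y y
              + Literature.Analysis.FluidPDE.convect V V y + gradient Q y
              = Laplacian.laplacian V y) →
        (∀ y : EuclideanSpace ℝ (Fin 3), (1 + ‖y‖) * ‖V y‖ ≤ C) →
        (∃ y : EuclideanSpace ℝ (Fin 3), Rot (ω * L) (V (Rot (-(ω * L)) y)) ≠ V y) →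
        α₁ ≤ |ω| ∧ |ω| ≤ α₂ :=
  stub_rotationWindow

/-- A nonpositive envelope constant carries no profile (landed `relativeEquilibrium_eq_zero_of_nonpos`, p150960). -/
example {C : ℝ} (hC : C ≤ 0) {V : EuclideanSpace ℝ (Fin 3) → EuclideanSpace ℝ (Fin 3)}
    (hVb : ∀ y : EuclideanSpace ℝ (Fin 3), (1 + ‖y‖) * ‖V y‖ ≤ C) : V = 0 :=
  relativeEquilibrium_eq_zero_of_nonpos hC hVb


/-! ### Tool stubs of lead c4 — NEAR-IDENTITY RIGIDITY of the crux's witness set (registered v6; ALL LANDED at v7)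

THEOREM (target of this block). Fix a Type-I constant `C₀`. If there are nontrivial Type-I (`C₀`) ancient mild solutions
`u_n`, rotated `c_n`-DSS about `e₃` through `rotZLIE θ_n` (ANY angles), with `1 < c_n → 1`, then a rotated SELF-SIMILAR
profile exists — `RssProfileExists` (stmt-16274), hence `CorkscrewProfile`. Contrapositive: `¬ CorkscrewProfile` upgrades
Chae–Wolf 2017 Thm 1.3 (plain `λ`-DSS, `λ` near `1`) to ALL rotated DSS about a fixed axis. Proof plan: (F1) RDSS algebra
(iterates, inverse, `2π`-periodicity, basis pinning of `rotZLIE`); (F2) Chae–Wolf's Step 1 with rotations in the Oseen gauge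
(a nontrivial field has a witness `‖V(t,x)‖ ≥ ε₀/2`, `t ∈ [−c², −1]`, `‖x‖ ≤ 2C₀/ε₀`); (F3) ANGLE TUNING for arbitrary angles
(Dirichlet's approximation theorem re-tunes `(c_n, θ_n) ↦ (c_n^{m_n}, m_nθ_n − 2πj_n → 0)`; then the rates `θ'_n / log c'_n`
either converge along a subsequence — exponents `⌊log μ / log c'_n⌋` give angles `→ β log μ` — or blow up —
`PineauVicol2026.exists_tuned_exponents` gives angles `→ 0`); (F4) KNSS Lemma 6.1 compactness in the Oseen-mild rate class
(`KNSS2009_lemma61_typeI_rate`) along the tuned exponents: a limit `W ∈ IsTypeIAncientMild C₀`, Type-I `C₀`, zero on `t ≥ 0`,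
`IsRotatedDSS μ (rotZLIE (Θ μ)) W` for all `μ ≥ 1`, nontrivial at `t = −1`; (F5) with `Θ μ = β log μ`: `β = 0` is excluded by
`chaeWolf2017_removing_dss_holds` (the limit would be self-similar), and `β ≠ 0` is an RSS profile with speed `α = −β/2`.

LANDED (v7, all sorry-free, axioms propext / Classical.choice / Quot.sound, namespace `…Theorems.CorkscrewProfile.Birth`):
F1 `stub_rdssIterate` p160957 (`Theorems/CorkscrewDynamoCorkscrewProfileRdssIterate.lean`: `IsRotatedDSS.trans_mul`, `rotZ_mul`,
`rotZ_iterate`, `rotZ_inv`, `isRotatedDSS_rotZ_sub_two_pi_mul_iff`, `rotZ_iterate_sub_two_pi_mul`, `rotZLIE_trans/symm/zero`);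
F2 `stub_rdssWitness` p161497 (`…RdssWitness.lean`: `IsRotatedDSS.norm_eq_mul`, `sqrt_neg_mul_norm_eq`, `exists_mem_Icc_of_rotZ`);
F3 `stub_angleTuning` p161926 (`…AngleTuning.lean`: `exists_denominators`, `exists_retune_angles`, `exists_rate_tuning`);
F4 `stub_rdssTunedCompactness` p162300 (`…RdssTunedCompactness.lean`: `isTypeIAncientMild_congr_neg`, `twisted_law_of_limit`,
`limit_ne_zero_of_witnesses`); F5 `stub_nearIdentityRigidity` p162589 (`…NearIdentityRigidity.lean`: `exists_rss_of_nearIdentity`,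
`rssProfileExists_of_nearIdentity_rdss`, `corkscrewProfile_of_nearIdentity_rdss`, `corkscrewProfile_of_nearIdentity_pinned`,
`nearIdentity_rdss_removal_of_not_rssProfileExists`, `nearIdentity_rdss_removal_of_not_corkscrewProfile`,
`rdss_removal_commensurable`, `quarterTurn_nearIdentityRemoval` = the literal statement of `QuarterTurnRdss.NearIdentityRemoval`,
stmt-1102); F6 `stub_rssWindow` p163469 (`…RssWindow.lean`: `rss_eq_pvAnsatz`, `rss_speed_mem_window`, `rss_angleRate_ne_zero` — PV 2026
Thm 1.4 in the Oseen gauge); F7 `stub_rssIffNearIdentity` p164031 (`…RssIffNearIdentity.lean`: `nearIdentity_of_rssProfileExists` and the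
`↔`). NET NEW LOGICAL POSITION: for each Type-I level `C₀`, either Chae–Wolf's near-identity removal holds for ALL rotated
DSS about `e₃` at that level, or `RssProfileExists` (stmt-16274) holds with that constant — in particular
`¬CorkscrewProfile ⟹` uniform near-identity RDSS removal at every level, and near-identity accumulation of corkscrew factors at a
bounded constant `⟹ CorkscrewProfile`. -/

/-- **Tool stub F1 `stub_rdssIterate` (S).** RDSS algebra about `e₃`: iterates `(c^k, kθ)`, the inverse pair
`(c⁻¹, −θ)`, `2π`-periodicity in the angle, and the basis pinning of `rotZLIE θ` (the `Rot` clause of `RssProfileExists`). -/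
theorem stub_rdssIterate :
    (∀ (c θ : ℝ) (u : ℝ → EuclideanSpace ℝ (Fin 3) → EuclideanSpace ℝ (Fin 3)),
      Literature.Analysis.FluidPDE.IsRotatedDSS c (Literature.Analysis.FluidPDE.rotZLIE θ) u →
        ∀ k : ℕ, Literature.Analysis.FluidPDE.IsRotatedDSS (c ^ k) (Literature.Analysis.FluidPDE.rotZLIE (k * θ)) u) ∧
    (∀ (c θ : ℝ) (u : ℝ → EuclideanSpace ℝ (Fin 3) → EuclideanSpace ℝ (Fin 3)), 0 < c →
      Literature.Analysis.FluidPDE.IsRotatedDSS c (Literature.Analysis.FluidPDE.rotZLIE θ) u →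
        Literature.Analysis.FluidPDE.IsRotatedDSS c⁻¹ (Literature.Analysis.FluidPDE.rotZLIE (-θ)) u) ∧
    (∀ (c θ : ℝ) (m : ℤ) (u : ℝ → EuclideanSpace ℝ (Fin 3) → EuclideanSpace ℝ (Fin 3)),
      Literature.Analysis.FluidPDE.IsRotatedDSS c (Literature.Analysis.FluidPDE.rotZLIE θ) u ↔
        Literature.Analysis.FluidPDE.IsRotatedDSS c (Literature.Analysis.FluidPDE.rotZLIE (θ - 2 * Real.pi * m)) u) ∧
    (∀ θ : ℝ, Literature.Analysis.FluidPDE.rotZLIE θ (EuclideanSpace.single 0 1) =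
        Real.cos θ • EuclideanSpace.single 0 1 + Real.sin θ • EuclideanSpace.single 1 1 ∧
      Literature.Analysis.FluidPDE.rotZLIE θ (EuclideanSpace.single 1 1) =
        -(Real.sin θ • EuclideanSpace.single 0 1) + Real.cos θ • EuclideanSpace.single 1 1 ∧
      Literature.Analysis.FluidPDE.rotZLIE θ (EuclideanSpace.single 2 1) = EuclideanSpace.single 2 1) :=
  Summit.NavierStokesRegularity.NavierStokesRegularity.Theorems.CorkscrewProfile.Birth.stub_rdssIterate

/-- **Tool stub F2 `stub_rdssWitness` (S/M) — Chae–Wolf 2017 §3 Step 1 with rotations, Oseen gauge.** There is an absolute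
`ε₀ > 0` such that every NONTRIVIAL Oseen-gauge Type-I field (`IsTypeIAncientMild C₀ V`, `HasTypeIDecay C₀ V`) which is
rotated `c`-DSS about `e₃`, `1 < c ≤ 2`, has a witness point `t ∈ [−c², −1]`, `‖x‖ ≤ 2C₀/ε₀`, `‖V(t,x)‖ ≥ ε₀/2`
(smallness `exists_typeIAncientMild_eq_zero_of_small` gives a point with `√(−t)‖V‖ > ε₀`; the rotated scaling, which
preserves `√(−t)‖V‖`, moves it into one period; `ChaeWolf.witness_of_point`). -/
theorem stub_rdssWitness :
    ∃ ε₀ : ℝ, 0 < ε₀ ∧ ∀ (C₀ c θ : ℝ) (V : ℝ → EuclideanSpace ℝ (Fin 3) → EuclideanSpace ℝ (Fin 3)), 1 < c → c ≤ 2 →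
      Literature.Analysis.FluidPDE.IsTypeIAncientMild C₀ V → Literature.Analysis.FluidPDE.HasTypeIDecay C₀ V →
      Literature.Analysis.FluidPDE.IsRotatedDSS c (Literature.Analysis.FluidPDE.rotZLIE θ) V →
      (∃ t < 0, ∃ x, V t x ≠ 0) →
      ∃ t ∈ Set.Icc (-c ^ 2) (-1), ∃ x : EuclideanSpace ℝ (Fin 3), ‖x‖ ≤ 2 * C₀ / ε₀ ∧ ε₀ / 2 ≤ ‖V t x‖ :=
  Summit.NavierStokesRegularity.NavierStokesRegularity.Theorems.CorkscrewProfile.Birth.stub_rdssWitness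

/-- **Tool stub F3 `stub_angleTuning` (M) — tuned exponents for ARBITRARY angles.** For factors `1 < c_n → 1` and any real
angles `θ_n` there are a subsequence `φ` and a rate `β` such that every `μ ≥ 1` is the limit of powers `c_{φ n}^{k_n}` whose
accumulated angles `k_n θ_{φ n}` tend to `β log μ` modulo `2π` (Dirichlet's approximation theorem
`Real.exists_int_int_abs_mul_sub_le` first re-tunes the angles to `0`; then either the rates `θ'/log c'` converge along a
subsequence, or they blow up and `PineauVicol2026.exists_tuned_exponents` applies with `β = 0`). -/
theorem stub_angleTuning :
    ∀ (c θ : ℕ → ℝ), (∀ n, 1 < c n) → Filter.Tendsto c Filter.atTop (nhds 1) →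
      ∃ (φ : ℕ → ℕ) (β : ℝ), StrictMono φ ∧ ∀ μ : ℝ, 1 ≤ μ →
        ∃ (k : ℕ → ℕ) (m : ℕ → ℤ), Filter.Tendsto (fun n => c (φ n) ^ k n) Filter.atTop (nhds μ) ∧
          Filter.Tendsto (fun n => (k n : ℝ) * θ (φ n) - 2 * Real.pi * (m n : ℝ)) Filter.atTop
            (nhds (β * Real.log μ)) :=
  Summit.NavierStokesRegularity.NavierStokesRegularity.Theorems.CorkscrewProfile.Birth.stub_angleTuning

/-- **Tool stub F4 `stub_rdssTunedCompactness` (L) — KNSS Lemma 6.1 compactness along tuned exponents, Oseen gauge.**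
Nontrivial Oseen-gauge Type-I fields `V_n` (`IsTypeIAncientMild C₀`, `HasTypeIDecay C₀`), rotated `c_n`-DSS about `e₃`
through `rotZLIE θ_n`, `1 < c_n ≤ 2`, `c_n → 1`, with exponents tuned to a prescribed angle function `Θ`, have a limit
`W ∈ IsTypeIAncientMild C₀` (Type-I `C₀`, zero on `t ≥ 0`) which is rotated `μ`-DSS through `rotZLIE (Θ μ)` for every `μ ≥ 1`
and nontrivial at `t = −1` (`KNSS2009_lemma61_typeI_rate`, `isTypeIAncientMild_of_continuous_oseenMild`, `stub_rdssWitness`). -/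
theorem stub_rdssTunedCompactness :
    ∀ (C₀ : ℝ) (c θ : ℕ → ℝ) (Θ : ℝ → ℝ) (V : ℕ → ℝ → EuclideanSpace ℝ (Fin 3) → EuclideanSpace ℝ (Fin 3)),
      0 < C₀ → (∀ n, 1 < c n) → (∀ n, c n ≤ 2) → Filter.Tendsto c Filter.atTop (nhds 1) →
      (∀ n, Literature.Analysis.FluidPDE.IsTypeIAncientMild C₀ (V n)) →
      (∀ n, Literature.Analysis.FluidPDE.HasTypeIDecay C₀ (V n)) →
      (∀ n, Literature.Analysis.FluidPDE.IsRotatedDSS (c n) (Literature.Analysis.FluidPDE.rotZLIE (θ n)) (V n)) →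
      (∀ n, ∃ t < 0, ∃ x, V n t x ≠ 0) →
      (∀ μ : ℝ, 1 ≤ μ → ∃ (k : ℕ → ℕ) (m : ℕ → ℤ), Filter.Tendsto (fun n => c n ^ k n) Filter.atTop (nhds μ) ∧
        Filter.Tendsto (fun n => (k n : ℝ) * θ n - 2 * Real.pi * (m n : ℝ)) Filter.atTop (nhds (Θ μ))) →
      ∃ W : ℝ → EuclideanSpace ℝ (Fin 3) → EuclideanSpace ℝ (Fin 3),
        Literature.Analysis.FluidPDE.IsTypeIAncientMild C₀ W ∧ Literature.Analysis.FluidPDE.HasTypeIDecay C₀ W ∧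
        (∀ t, 0 ≤ t → W t = 0) ∧
        (∀ μ : ℝ, 1 ≤ μ → Literature.Analysis.FluidPDE.IsRotatedDSS μ (Literature.Analysis.FluidPDE.rotZLIE (Θ μ)) W) ∧
        ∃ x, W (-1) x ≠ 0 :=
  Summit.NavierStokesRegularity.NavierStokesRegularity.Theorems.CorkscrewProfile.Birth.stub_rdssTunedCompactness

/-- **Tool stub F5 `stub_nearIdentityRigidity` (M) — the assembly.** (i) Near-identity nontrivial Type-I rotated-DSS ancient
mild solutions about `e₃` at a bounded constant force `RssProfileExists` (hence the crux); (ii) contrapositive for the crux in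
its own vocabulary: if there is no corkscrew, Chae–Wolf's near-identity removal holds for all rotated DSS about `e₃`. -/
theorem stub_nearIdentityRigidity :
    (∀ (C₀ : ℝ) (c θ : ℕ → ℝ) (u : ℕ → ℝ → EuclideanSpace ℝ (Fin 3) → EuclideanSpace ℝ (Fin 3)),
      (∀ n, 1 < c n) → Filter.Tendsto c Filter.atTop (nhds 1) →
      (∀ n, Literature.Analysis.FluidPDE.IsAncientMildSolution 1 (u n)) →
      (∀ n, ∀ t < 0, MeasureTheory.AEStronglyMeasurable (u n t) MeasureTheory.volume) →
      (∀ n, Literature.Analysis.FluidPDE.IsRotatedDSS (c n) (Literature.Analysis.FluidPDE.rotZLIE (θ n)) (u n)) →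
      (∀ n, Literature.Analysis.FluidPDE.HasTypeIDecay C₀ (u n)) →
      (∀ n, ¬ ∀ t < 0, u n t =ᵐ[MeasureTheory.volume] 0) →
      Summit.NavierStokesRegularity.NavierStokesRegularity.Theses.FilamentSkeletonRss.RssProfileExists) ∧
    (¬ Summit.NavierStokesRegularity.NavierStokesRegularity.Theses.CorkscrewDynamo.CorkscrewProfile →
      ∀ C₀ : ℝ, ∃ c₁ : ℝ, 1 < c₁ ∧
        ∀ (c θ : ℝ) (R : EuclideanSpace ℝ (Fin 3) ≃ₗᵢ[ℝ] EuclideanSpace ℝ (Fin 3))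
          (u : ℝ → EuclideanSpace ℝ (Fin 3) → EuclideanSpace ℝ (Fin 3)), 1 < c → c < c₁ →
          (∀ x : EuclideanSpace ℝ (Fin 3), R x 0 = Real.cos θ * x 0 - Real.sin θ * x 1 ∧
            R x 1 = Real.sin θ * x 0 + Real.cos θ * x 1 ∧ R x 2 = x 2) →
          Literature.Analysis.FluidPDE.IsAncientMildSolution 1 u →
          (∀ t < 0, MeasureTheory.AEStronglyMeasurable (u t) MeasureTheory.volume) →
          Literature.Analysis.FluidPDE.IsRotatedDSS c R u → Literature.Analysis.FluidPDE.HasTypeIDecay C₀ u →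
          ∀ t < 0, u t =ᵐ[MeasureTheory.volume] 0) :=
  Summit.NavierStokesRegularity.NavierStokesRegularity.Theorems.CorkscrewProfile.Birth.stub_nearIdentityRigidity


/-- **Tool stub F6 `stub_rssWindow` (M) — Pineau–Vicol 2026 Thm 1.4 in the Oseen gauge.** For every Type-I level `C₀ > 0`
there are speeds `0 < α₁, α₂` (those of `pineauVicol2026_rss_liouville_holds`) such that every NONTRIVIAL Oseen-gauge Type-I
field `W` (`IsTypeIAncientMild C₀ W`, `HasTypeIDecay C₀ W`, `W(−1) ≠ 0`) which is rotated self-similar about `e₃` with angle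
rate `β` (`IsRotatedDSS μ (rotZLIE (β log μ)) W` for all `μ > 0`) has speed `|α| = |β|/2 ∈ [α₁, α₂]`: the RSS law at
`μ = (−t)^{−1/2}` is the Pineau–Vicol ansatz `W = pvAnsatz (−β/2) (W(−1))` on the past, `W` is classical on `[−1,0)` for a global
pressure, and Thm 1.4 kills the profile outside the window. Sharpens `exists_rss_of_nearIdentity` (the RSS field produced by
near-identity accumulation has speed in PV's intermediate window; in particular `β ≠ 0` without Chae–Wolf). -/
theorem stub_rssWindow :
    ∀ C₀ : ℝ, 0 < C₀ → ∃ α₁ α₂ : ℝ, 0 < α₁ ∧ 0 < α₂ ∧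
      ∀ (β : ℝ) (W : ℝ → EuclideanSpace ℝ (Fin 3) → EuclideanSpace ℝ (Fin 3)),
        Literature.Analysis.FluidPDE.IsTypeIAncientMild C₀ W → Literature.Analysis.FluidPDE.HasTypeIDecay C₀ W →
        (∀ μ : ℝ, 0 < μ → Literature.Analysis.FluidPDE.IsRotatedDSS μ (Literature.Analysis.FluidPDE.rotZLIE (β * Real.log μ)) W) →
        (∃ x, W (-1) x ≠ 0) → α₁ ≤ |β| / 2 ∧ |β| / 2 ≤ α₂ :=
  Summit.NavierStokesRegularity.NavierStokesRegularity.Theorems.CorkscrewProfile.Birth.stub_rssWindow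


/-- **Tool stub F7 `stub_rssIffNearIdentity` (S) — the open stub, reformulated.** `RssProfileExists` (stmt-16274) holds iff, at
some Type-I level `C₀`, NONTRIVIAL Type-I ancient mild solutions rotated `c`-DSS about `e₃` (any angles, no essential-rotation
clause) exist with factors `c` arbitrarily close to `1` (`→`: an RSS profile is rotated DSS for every factor; `←`:
`rssProfileExists_of_nearIdentity_rdss`). -/
theorem stub_rssIffNearIdentity :
    Summit.NavierStokesRegularity.NavierStokesRegularity.Theses.FilamentSkeletonRss.RssProfileExists ↔
      ∃ C₀ : ℝ, ∀ δ : ℝ, 0 < δ →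
        ∃ (c θ : ℝ) (u : ℝ → EuclideanSpace ℝ (Fin 3) → EuclideanSpace ℝ (Fin 3)), 1 < c ∧ c < 1 + δ ∧
          Literature.Analysis.FluidPDE.IsAncientMildSolution 1 u ∧
          (∀ t < 0, MeasureTheory.AEStronglyMeasurable (u t) MeasureTheory.volume) ∧
          Literature.Analysis.FluidPDE.IsRotatedDSS c (Literature.Analysis.FluidPDE.rotZLIE θ) u ∧
          Literature.Analysis.FluidPDE.HasTypeIDecay C₀ u ∧ ¬ ∀ t < 0, u t =ᵐ[MeasureTheory.volume] 0 :=
  Summit.NavierStokesRegularity.NavierStokesRegularity.Theorems.CorkscrewProfile.Birth.stub_rssIffNearIdentity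


/-! ### Tool stubs of lead c5 — CO-ROTATION NECESSITY via the ROTATION-GAUGED HEAD PRESSURE (registered v10; ALL LANDED at v11: T1 p167704, T2 p167903, T3 p168213, T4 p168026, T5 p168119, T6+T7 p168449 `Theorems/CorkscrewDynamoCorkscrewProfileCoRotationNecessity.lean`, which also lands `exists_corotating_vorticity_of_ne_zero`, `rotatedLerayProfile_vorticity_on_corotationSphere` (off the OPEN co-rotation ball the vorticity lies ON the sphere |ω − αe₃| = |α| everywhere) and `relativeEquilibrium_eq_zero_of_counterRotating` (the v1–v3 stub vocabulary))

THEOREM (target of this block). Let `(U, P)` be a smooth solution of Perelman's rotated Leray profile system with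
angular velocity `α` (the line's object: a relative equilibrium of Leray's backward system, `relativeEquilibrium_iff_rotatedLerayProfile`),
with the profile Type-I decay `‖U y‖ ≤ C₀/(1+‖y‖)` and bounded pressure. If the vertical vorticity never co-rotates with the
pattern, `α · (curl U)₃ ≤ 0` on `ℝ³`, then `U ≡ 0`. More precisely the ROTATION-GAUGED HEAD
`Π_α := P + ½|U|² + ½⟪y, U⟫ − α⟪Jy, U⟫` (`J = rotGen = e₃ × ·`) satisfies, for the CO-ROTATING drift operator
`L_α f := Δf − Df[U + ½y − αJy]`, the exact identity `L_α Π_α = |curl U|² − 2α (curl U)₃ = |curl U − αe₃|² − α²`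
(the "α-dependent modification of the Bernoulli function" that Pineau–Vicol, arXiv:2607.09619 p. 4, report as unknown;
kernel-checked first for crux stmt-…-2955 in `Cruxes/FrequencyRigidity/Ideator1TorqueProof.lean`, idea card
`rotation-gauged-head`, there unlanded), so `Π_α` is a bounded subsolution as soon as the vorticity avoids the open
co-rotation ball `B(αe₃, |α|)`; Tsai's Liouville lemma (here generalised to drifts with a skew linear part, to which the
radial barriers are blind) makes `Π_α` constant, and then `|curl U|² ≡ 2α(curl U)₃`; under the sign hypothesis `curl U ≡ 0`,
`DU` is symmetric, `∇Π_α = ΔU ≡ 0`, and a harmonic field with Type-I decay vanishes. At `α = 0` this is Tsai 1998 Thm 1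
(`IsLerayProfile.eq_zero_of_growth`); for `α ≠ 0` it is a NEW necessary condition on the line's witness: a relative
equilibrium generating a corkscrew has vertical vorticity STRICTLY co-rotating with the pattern somewhere (indeed somewhere
`|curl U − αe₃| < |α|`). The analytic pieces are stated coordinate-free on a finite-dimensional inner product space `E` with a
general skew operator `A` (= `α • rotGenL` on `ℝ³`) and the general rate `a` (= `½`), viscosity `ν` (= `1`), in the exact
vocabulary of `Literature.Analysis.FluidPDE.TsaiProfileEndgame` / `TsaiMaximumPrinciple` / `LerayProfileCalculus`. -/

section RotationGaugedHead

open Literature.Analysis.FluidPDE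
open scoped RealInnerProductSpace Laplacian ENNReal

variable {E : Type*} [NormedAddCommGroup E] [InnerProductSpace ℝ E] [FiniteDimensional ℝ E]

/-- **Tool stub T1 `stub_skewDriftLiouville` (L) — Tsai's Liouville-type Lemma 5.1 with a SKEW LINEAR DRIFT added.**
Let `ν > 0`, `0 ≤ b < a`, `S : E →L[ℝ] E` with `⟪S v, v⟫ = 0` for all `v`, `Θ ∈ C²(E)` polynomially bounded,
`U : E → E` with the affine bound `‖U y‖ ≤ M + b‖y‖`, and `ν ΔΘ − DΘ[U + a y − S y] ≥ 0` on `E`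
(i.e. `0 ≤ driftOp ν a (U − S) Θ`). Then `Θ` is constant. (The tree's `isConst_of_driftOp_nonneg` is `S = 0`;
its Gaussian barriers centred at `x₀` see the skew drift only through the CONSTANT vector `−S x₀`, since
`⟪y − x₀, S y⟫ = ⟪y − x₀, S x₀⟫`.) -/
theorem stub_skewDriftLiouville {ν a b M C : ℝ} {N : ℕ} (hν : 0 < ν) (hb : 0 ≤ b) (hba : b < a)
    (S : E →L[ℝ] E) (hS : ∀ v : E, ⟪S v, v⟫ = 0)
    {Θ : E → ℝ} {U : E → E} (hΘ : ContDiff ℝ 2 Θ)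
    (hsub : ∀ y, 0 ≤ driftOp ν a (fun z => U z - S z) Θ y)
    (hU : ∀ y, ‖U y‖ ≤ M + b * ‖y‖)
    (hgrowth : ∀ y, |Θ y| ≤ C * (1 + ‖y‖) ^ N) (x y : E) : Θ x = Θ y :=
  Summit.NavierStokesRegularity.NavierStokesRegularity.Theorems.CorkscrewProfile.Birth.stub_skewDriftLiouville hν hb hba S hS hΘ hsub hU hgrowth x y

/-- **Tool stub T2 `stub_rotatedPressurePoisson` (M) — the pressure Poisson equation of the ROTATED profile system.**
For `U ∈ C³`, `P ∈ C²`, `div U = 0` and `−νΔU + aU + aDU[y] + (A U − DU[A y]) + DU[U] + ∇P = 0` with ANY continuous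
linear `A` (the rotation forcing is divergence free: `div (A ∘ U) = tr (A ∘ DU) = tr (DU ∘ A) = div (y ↦ DU[A y])` for
`div U = 0`; Pineau–Vicol 2026, proof of Lemma 2.1, p. 9), `ΔP = −tr (DU ∘ DU)` — exactly as for `A = 0`
(`IsLerayProfile.laplacian_pressure_eq`). -/
theorem stub_rotatedPressurePoisson {ν a : ℝ} {U : E → E} {P : E → ℝ} (A : E →L[ℝ] E)
    (hU3 : ContDiff ℝ 3 U) (hP2 : ContDiff ℝ 2 P) (hdiv : VectorCalculus.IsDivFree U)
    (heq : ∀ y, -(ν • (Δ U) y) + a • U y + a • fderiv ℝ U y y + (A (U y) - fderiv ℝ U y (A y)) +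
      convect U U y + gradient P y = 0)
    (y : E) : (Δ P) y = -traceCLM ((fderiv ℝ U y).comp (fderiv ℝ U y)) :=
  Summit.NavierStokesRegularity.NavierStokesRegularity.Theorems.CorkscrewProfile.Birth.stub_rotatedPressurePoisson A hU3 hP2 hdiv heq y

/-- **Tool stub T3 `stub_rotatedHeadIdentity` (M–L) — the ROTATION-GAUGED HEAD PRESSURE IDENTITY, coordinate-free.**
For a SKEW `A` (`⟪A v, w⟫ = −⟪v, A w⟫`), `U ∈ C³`, `P ∈ C²`, `div U = 0`, the rotated profile system and the pressure
Poisson equation, the gauged head `Π_A := Π − ⟪A y, U⟫ = ½|U|² + P + a⟪y, U⟫ − ⟪A y, U⟫` and the co-rotating drift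
`b := U + a y − A y` satisfy `ν ΔΠ_A − DΠ_A[b] = (ν/2)|DU − DUᵀ|² + 2ν tr (A ∘ DU)` (on `ℝ³` with `A = αJ`:
`= ν(|curl U|² − 2α (curl U)₃)`). Proof: `ΔΠ_A = ⟪b, ΔU⟫ + |DU|² − tr (DU∘DU) + 2 tr (A∘DU)` (`laplacian_headPressure`,
`laplacian_inner_eq` for `y ↦ ⟪A y, U y⟫`, `∑ᵢ ⟪A bᵢ, DU bᵢ⟫ = −tr (A∘DU)`), `DΠ_A[b] = ⟪b, DU b⟫ + DP[b] + a⟪b, U⟫ − ⟪A b, U⟫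
= ν⟪ΔU, b⟫` (the system paired with the single vector `b`, `⟪A U, b⟫ = −⟪A b, U⟫`), and `|DU|² − tr (DU∘DU) = ½|DU − DUᵀ|²`
(`frobeniusNormSq_sub_adjoint`). The case `A = 0` is `IsLerayProfile.driftOp_headPressure_eq_spin`. -/
theorem stub_rotatedHeadIdentity {ν a : ℝ} {U : E → E} {P : E → ℝ} (A : E →L[ℝ] E)
    (hA : ∀ v w : E, ⟪A v, w⟫ = -⟪v, A w⟫)
    (hU3 : ContDiff ℝ 3 U) (hP2 : ContDiff ℝ 2 P) (hdiv : VectorCalculus.IsDivFree U)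
    (heq : ∀ y, -(ν • (Δ U) y) + a • U y + a • fderiv ℝ U y y + (A (U y) - fderiv ℝ U y (A y)) +
      convect U U y + gradient P y = 0)
    (hΔP : ∀ y, (Δ P) y = -traceCLM ((fderiv ℝ U y).comp (fderiv ℝ U y)))
    (y : E) :
    driftOp ν a (fun z => U z - A z) (fun z => headPressure a U P z - ⟪A z, U z⟫) y =
      ν / 2 * frobeniusNormSq (spin U y) + 2 * ν * traceCLM (A.comp (fderiv ℝ U y)) :=
  Summit.NavierStokesRegularity.NavierStokesRegularity.Theorems.CorkscrewProfile.Birth.stub_rotatedHeadIdentity A hA hU3 hP2 hdiv heq hΔP y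

omit [FiniteDimensional ℝ E] in
/-- **Tool stub T4 `stub_rotatedHeadGrowth` (S) — polynomial growth of the gauged head.** From a bound `‖U‖ ≤ M` and a
polynomial bound on `P`: `|Π_A(y)| ≤ (½M² + C + (a + ‖A‖) M)(1 + ‖y‖)^{N+2}` (cf. `abs_headPressure_le`; the new term is
`|⟪A y, U y⟫| ≤ ‖A‖ ‖y‖ M`). -/
theorem stub_rotatedHeadGrowth {a M C : ℝ} {N : ℕ} {U : E → E} {P : E → ℝ} (A : E →L[ℝ] E)
    (ha : 0 ≤ a) (hM : 0 ≤ M) (hC : 0 ≤ C)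
    (hU : ∀ y, ‖U y‖ ≤ M) (hP : ∀ y, |P y| ≤ C * (1 + ‖y‖) ^ N) (y : E) :
    |headPressure a U P y - ⟪A y, U y⟫| ≤ (2⁻¹ * M ^ 2 + C + (a + ‖A‖) * M) * (1 + ‖y‖) ^ (N + 2) :=
  Summit.NavierStokesRegularity.NavierStokesRegularity.Theorems.CorkscrewProfile.Birth.stub_rotatedHeadGrowth A ha hM hC hU hP y

/-- **Tool stub T5 `stub_rotatedLaplacianZero` (M) — endgame, first half: a critical point of the gauged head with
symmetric velocity gradient is a zero of `ΔU`.** If `DΠ_A(y) = 0` and `spin U y = DU − DUᵀ = 0` then, pairing the system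
with `w = ΔU(y)` exactly as in `IsLerayProfile.laplacian_eq_zero_of_headPressure_const_of_contDiff` (the two `A`-terms
combine through `⟪A y, DU w⟫ = ⟪DU (A y), w⟫` and `−⟪A w, U⟫ = ⟪w, A U⟫`), `ν|ΔU(y)|² = 0`. -/
theorem stub_rotatedLaplacianZero {ν a : ℝ} {U : E → E} {P : E → ℝ} (A : E →L[ℝ] E)
    (hA : ∀ v w : E, ⟪A v, w⟫ = -⟪v, A w⟫) (hν : ν ≠ 0)
    (hU3 : ContDiff ℝ 3 U) (hP2 : ContDiff ℝ 2 P)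
    (heq : ∀ y, -(ν • (Δ U) y) + a • U y + a • fderiv ℝ U y y + (A (U y) - fderiv ℝ U y (A y)) +
      convect U U y + gradient P y = 0)
    {y : E} (hD0 : ∀ w, fderiv ℝ (fun z => headPressure a U P z - ⟪A z, U z⟫) y w = 0)
    (hspin : spin U y = 0) : (Δ U) y = 0 :=
  Summit.NavierStokesRegularity.NavierStokesRegularity.Theorems.CorkscrewProfile.Birth.stub_rotatedLaplacianZero A hA hν hU3 hP2 heq hD0 hspin

/-- **Assembly T6 (lead) `rotatedLerayProfile_eq_zero_of_trace_nonneg` — CO-ROTATION NECESSITY, general form.**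
`ν > 0`, `a > 0`, `A` skew, `U ∈ C³` bounded and in some `L^q` (`1 ≤ q < ∞`), `P ∈ C²` polynomially bounded, `div U = 0`,
the rotated profile system, and the sign condition `0 ≤ tr (A ∘ DU)` everywhere (on `ℝ³`, `A = αJ`: `α (curl U)₃ ≤ 0`)
force `U ≡ 0` (T2–T5 + T1 + the tree's harmonic Liouville theorem `eq_zero_of_harmonic_memLp_inner`). -/
theorem rotatedLerayProfile_eq_zero_of_trace_nonneg [MeasurableSpace E] [BorelSpace E] [Nontrivial E]
    {ν a : ℝ} (hν : 0 < ν) (ha : 0 < a) {U : E → E} {P : E → ℝ} (A : E →L[ℝ] E)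
    (hA : ∀ v w : E, ⟪A v, w⟫ = -⟪v, A w⟫)
    (hU3 : ContDiff ℝ 3 U) (hP2 : ContDiff ℝ 2 P) (hdiv : VectorCalculus.IsDivFree U)
    (heq : ∀ y, -(ν • (Δ U) y) + a • U y + a • fderiv ℝ U y y + (A (U y) - fderiv ℝ U y (A y)) +
      convect U U y + gradient P y = 0)
    {M C : ℝ} {N : ℕ} (hUb : ∀ y, ‖U y‖ ≤ M) (hPC : ∀ y, |P y| ≤ C * (1 + ‖y‖) ^ N)
    {q : ℝ≥0∞} (hq1 : 1 ≤ q) (hq : q ≠ ⊤) (hUq : MeasureTheory.MemLp U q MeasureTheory.volume)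
    (hsign : ∀ y, 0 ≤ traceCLM (A.comp (fderiv ℝ U y))) : U = 0 :=
  Summit.NavierStokesRegularity.NavierStokesRegularity.Theorems.CorkscrewProfile.Birth.rotatedLerayProfile_eq_zero_of_trace_nonneg hν ha A hA hU3 hP2 hdiv heq hUb hPC hq1 hq hUq hsign

/-- **Corollary T7 (lead) `rotatedLerayProfile_eq_zero_of_counterRotating` — the line's vocabulary on `ℝ³`.** A smooth
solution of Perelman's rotated Leray profile system (`ν = 1`, `a = ½`, rotation `α` about `e₃`) with the profile Type-I decay
and bounded pressure, whose vertical vorticity never co-rotates with the pattern (`α (curl U)₃ ≤ 0` on `ℝ³`), is trivial.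
Contrapositive: the relative equilibrium behind any corkscrew of this line has `α (curl U)₃ > 0` somewhere. -/
theorem rotatedLerayProfile_eq_zero_of_counterRotating {α C₀ M : ℝ}
    {U : EuclideanSpace ℝ (Fin 3) → EuclideanSpace ℝ (Fin 3)} {P : EuclideanSpace ℝ (Fin 3) → ℝ}
    (hU : ContDiff ℝ (⊤ : ℕ∞) U) (hP : ContDiff ℝ (⊤ : ℕ∞) P) (hdiv : VectorCalculus.IsDivFree U)
    (heq : ∀ y : EuclideanSpace ℝ (Fin 3),
      α • (rotGen (U y) - fderiv ℝ U y (rotGen y)) + (1 / 2 : ℝ) • U y + (1 / 2 : ℝ) • fderiv ℝ U y y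
        - (Δ U) y + fderiv ℝ U y (U y) + gradient P y = 0)
    (hdec : ∀ y : EuclideanSpace ℝ (Fin 3), ‖U y‖ ≤ C₀ / (1 + ‖y‖))
    (hPM : ∀ y : EuclideanSpace ℝ (Fin 3), |P y| ≤ M)
    (hsign : ∀ y : EuclideanSpace ℝ (Fin 3), α * (curl U y) 2 ≤ 0) : U = 0 :=
  Summit.NavierStokesRegularity.NavierStokesRegularity.Theorems.CorkscrewProfile.Birth.rotatedLerayProfile_eq_zero_of_counterRotating hU hP hdiv heq hdec hPM hsign

/-! #### Tool stubs of lead c5, wave 2 (registered v11; ALL LANDED at v12: T8 p168911, T9 p168986, T10 p168961, T11 p169500 `Theorems/CorkscrewDynamoCorkscrewProfileRssCoRotation.lean`) — lifting the co-rotation necessity to `RssProfileExists` itself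

From the DATA of `RssProfileExists` (stmt-16274: `α ≠ 0`, `C₀`, `U ∈ C²`, `Rot` pinned on the basis, `u` ancient mild, measurable,
Type-I `C₀`, `u(−1) = U`, rotated DSS for every factor `c > 0` through `Rot(−2α log c)`) we extract a smooth ROTATED LERAY PROFILE
`(U, P)` with the Type-I profile decay and POLYNOMIALLY bounded pressure: T10 the Oseen-gauge representative `V` (c3's
`stub_sharpRepresentative`) coincides with the ansatz field `pvAnsatz α U` on `t < 0` and is classical for a smooth pressure `q`;
T8 the rotating wave `lerayOrbit V = (s, y) ↦ R(αs) U(R(−αs) y)` solves the backward Leray system, and differentiating the wave at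
`s = 0` gives Perelman's rotated profile system for `(U, q(−1))`; T9 the pressure of a classical Type-I solution on `(−∞, 0)` has
polynomial growth at `t = −1` (Pineau–Vicol's pressure identification `∇p = ∇Q[u]`, the gradient bound on the potential `Q` and the
cylinder regularity `‖Dⁿu(t)‖ ≲ max{|x|, √−t}^{−n−1}`, all proved in the tree). T11 (lead) assembles: every witness of `RssProfileExists`
is a rotated Leray profile with polynomially bounded pressure, hence (T6 with polynomial pressure) has vertical vorticity co-rotating
with the pattern somewhere, `α (curl U)₃ > 0` — a necessary condition stated in stmt-16274's own vocabulary. -/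

/-- **Tool stub T8 `stub_rotatingWaveProfileEq` (M) — a rotating-wave solution of the backward Leray system is a rotated Leray
profile.** If the uniformly rotating field `(s, y) ↦ R(αs) U(R(−αs) y)` (with some pressure `P`) is a classical solution of the
backward Leray system `∂ₛW + ½W + ½DW[y] + DW[W] + ∇P = ΔW` on `ℝ × ℝ³` and `U` is smooth, then `(U, P(0,·))` solves Perelman's
rotated profile system `α(JU − DU[Jy]) + ½U + ½DU[y] − ΔU + DU[U] + ∇P₀ = 0` (`∂ₛW(0) = α(JU − DU[Jy])` by
`hasDerivAt_rotZ_comp`; `W(0) = U`; `timeDerivWithin univ = deriv`; `IsBackwardLeraySolutionOn.momentum_leray`). Converse of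
c1's `stub_corotatingFrame`. -/
theorem stub_rotatingWaveProfileEq {α : ℝ}
    {U : EuclideanSpace ℝ (Fin 3) → EuclideanSpace ℝ (Fin 3)} {P : ℝ → EuclideanSpace ℝ (Fin 3) → ℝ}
    (hU : ContDiff ℝ (⊤ : ℕ∞) U)
    (hL : IsBackwardLeraySolutionOn Set.univ 1 (fun s y => rotZ (α * s) (U (rotZ (-(α * s)) y))) P) :
    ∀ y : EuclideanSpace ℝ (Fin 3),
      α • (rotGen (U y) - fderiv ℝ U y (rotGen y)) + (1 / 2 : ℝ) • U y + (1 / 2 : ℝ) • fderiv ℝ U y y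
        - (Δ U) y + fderiv ℝ U y (U y) + gradient (P 0) y = 0 :=
  Summit.NavierStokesRegularity.NavierStokesRegularity.Theorems.CorkscrewProfile.Birth.stub_rotatingWaveProfileEq hU hL

/-- **Tool stub T9 `stub_typeIPressureGrowth` (M–L) — polynomial growth of the pressure of a classical Type-I solution.**
For a classical solution `(u, p)` of Navier–Stokes on `(−∞, 0)` with the Type-I bound `‖u(t,x)‖ ≤ C₀/(‖x‖ + √−t)`, the pressure
slice at `t = −1` grows at most polynomially: `|p(−1,x) − p(−1,0)| ≤ A(1+‖x‖)⁴`. Proof: time-translate by `½` so that `t = −1`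
becomes the interior time `−½` of `[−1,0)` (the translate is classical there with the same Type-I constant, `√(½−t) ≥ √−t`);
`PineauVicol2026.gradient_pressure_eq_of_typeI` identifies `∇p(−1) = ∇Q[u(−1)]` (`Q = pressurePotential`);
`exists_forall_iteratedFDeriv_le_of_typeI` (k ≤ 3) bounds the derivatives of `u(−1)`, `norm_fderiv_pressureSource_le` the source
gradient, `exists_bound_fderiv_pressurePotential` gives `‖∇Q[u(−1)](x)‖ ≤ K(B + C₀²(2+‖x‖)³)`; integrate along the segment
(mean value inequality). -/
theorem stub_typeIPressureGrowth {C₀ : ℝ}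
    {u : ℝ → EuclideanSpace ℝ (Fin 3) → EuclideanSpace ℝ (Fin 3)} {p : ℝ → EuclideanSpace ℝ (Fin 3) → ℝ}
    (hsol : IsClassicalNSSolutionOn (Set.Iio 0) 1 0 u p)
    (hI : ∀ t ∈ Set.Iio (0 : ℝ), ∀ x : EuclideanSpace ℝ (Fin 3), ‖u t x‖ ≤ C₀ / (‖x‖ + Real.sqrt (-t))) :
    ∃ A : ℝ, ∀ x : EuclideanSpace ℝ (Fin 3), |p (-1) x - p (-1) 0| ≤ A * (1 + ‖x‖) ^ 4 :=
  Summit.NavierStokesRegularity.NavierStokesRegularity.Theorems.CorkscrewProfile.Birth.stub_typeIPressureGrowth hsol hI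

/-- **Tool stub T10 `stub_rssDataClassical` (M) — the classical ansatz representative of an RSS field.** From the data of
`RssProfileExists`: the Oseen-gauge representative `V` of `u` (c3's `stub_sharpRepresentative`: `IsTypeIAncientMild C₀ V`, Type-I
`C₀`, `V t = u t` a.e. for `t < 0`) is classical on `(−∞,0)` for a smooth pressure (`exists_isClassicalNSSolutionOn_Iio_of_isTypeIAncientMild`),
and COINCIDES with the ansatz field on the past: `u t x = pvAnsatz α U t x` for `t < 0` by the RSS law at the factor `c = (−t)^{−1/2}`
(`Rot = rotZLIE` by the basis pinning; cf. `rss_eq_pvAnsatz`), both `V t` and `pvAnsatz α U t` are continuous, and two continuous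
functions equal a.e. are equal; in particular `V(−1) = U` (`pvAnsatz_neg_one`). -/
theorem stub_rssDataClassical {α C₀ : ℝ} {U : EuclideanSpace ℝ (Fin 3) → EuclideanSpace ℝ (Fin 3)}
    {Rot : ℝ → (EuclideanSpace ℝ (Fin 3) ≃ₗᵢ[ℝ] EuclideanSpace ℝ (Fin 3))}
    {u : ℝ → EuclideanSpace ℝ (Fin 3) → EuclideanSpace ℝ (Fin 3)}
    (hRot : ∀ θ : ℝ, Rot θ (EuclideanSpace.single 0 1) = Real.cos θ • EuclideanSpace.single 0 1 + Real.sin θ • EuclideanSpace.single 1 1 ∧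
      Rot θ (EuclideanSpace.single 1 1) = -(Real.sin θ • EuclideanSpace.single 0 1) + Real.cos θ • EuclideanSpace.single 1 1 ∧
      Rot θ (EuclideanSpace.single 2 1) = EuclideanSpace.single 2 1)
    (hU2 : ContDiff ℝ 2 U) (hu1 : u (-1) = U)
    (hrss : ∀ c : ℝ, 0 < c → IsRotatedDSS c (Rot (-(α * (2 * Real.log c)))) u)
    (hmild : IsAncientMildSolution 1 u) (hmeas : ∀ t < 0, MeasureTheory.AEStronglyMeasurable (u t) MeasureTheory.volume)
    (hC : HasTypeIDecay C₀ u) :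
    ∃ (V : ℝ → EuclideanSpace ℝ (Fin 3) → EuclideanSpace ℝ (Fin 3)) (q : ℝ → EuclideanSpace ℝ (Fin 3) → ℝ),
      IsTypeIAncientMild C₀ V ∧ HasTypeIDecay C₀ V ∧ IsClassicalNSSolutionOn (Set.Iio 0) 1 0 V q ∧
      (∀ t < 0, ∀ x, V t x = pvAnsatz α (fun y _ => U y) t x) ∧ V (-1) = U :=
  Summit.NavierStokesRegularity.NavierStokesRegularity.Theorems.CorkscrewProfile.Birth.stub_rssDataClassical hRot hU2 hu1 hrss hmild hmeas hC

/-- **Assembly T11 (lead) `rssProfileExists_rotatedLerayProfile` — every RSS profile is a rotated Leray profile with polynomially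
bounded pressure and has co-rotating vertical vorticity somewhere.** `RssProfileExists` (stmt-16274) implies: there are `α ≠ 0`,
`C₀`, a smooth nontrivial divergence-free `U` with `‖U y‖ ≤ C₀/(1+‖y‖)` and a smooth `P` with `|P y| ≤ M(1+‖y‖)^N` solving
Perelman's rotated profile system, AND a point where `α (curl U)₃ > 0` (T8–T10, the general co-rotation theorem T6 with polynomial
pressure). -/
theorem rssProfileExists_rotatedLerayProfile
    (h : Summit.NavierStokesRegularity.NavierStokesRegularity.Theses.FilamentSkeletonRss.RssProfileExists) :
    ∃ (α C₀ M : ℝ) (N : ℕ) (U : EuclideanSpace ℝ (Fin 3) → EuclideanSpace ℝ (Fin 3)) (P : EuclideanSpace ℝ (Fin 3) → ℝ),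
      α ≠ 0 ∧ U ≠ 0 ∧ ContDiff ℝ (⊤ : ℕ∞) U ∧ ContDiff ℝ (⊤ : ℕ∞) P ∧ VectorCalculus.IsDivFree U ∧
      (∀ y : EuclideanSpace ℝ (Fin 3),
        α • (rotGen (U y) - fderiv ℝ U y (rotGen y)) + (1 / 2 : ℝ) • U y + (1 / 2 : ℝ) • fderiv ℝ U y y
          - (Δ U) y + fderiv ℝ U y (U y) + gradient P y = 0) ∧
      (∀ y : EuclideanSpace ℝ (Fin 3), ‖U y‖ ≤ C₀ / (1 + ‖y‖)) ∧
      (∀ y : EuclideanSpace ℝ (Fin 3), |P y| ≤ M * (1 + ‖y‖) ^ N) ∧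
      ∃ y : EuclideanSpace ℝ (Fin 3), 0 < α * (curl U y) 2 :=
  Summit.NavierStokesRegularity.NavierStokesRegularity.Theorems.CorkscrewProfile.Birth.rssProfileExists_rotatedLerayProfile h


/-! ### Tool stubs of lead c6 — STRICT CO-ROTATION via the VERTICAL-VORTICITY FLUX IDENTITY (registered v13)

THEOREM (target of this block). Let `(U, P)` be a smooth solution of Perelman's rotated Leray profile system (any `α`) with the
profile Type-I decay `‖U y‖ ≤ C₀/(1+‖y‖)`, polynomially bounded pressure and the Type-I DERIVATIVE decay
`‖DU(y)‖ ≤ K/(1+‖y‖)²`, `‖D(curl U)(y)‖ ≤ K/(1+‖y‖)³` (automatic for the data of `RssProfileExists`: Pineau–Vicol 2026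
Lemma 7.1, tree `exists_forall_iteratedFDeriv_le_of_typeI`, packaged as V4). Then:
(A1) if the vertical vorticity is CYCLONIC everywhere, `α ω₃ ≥ 0`, and integrable, then `U ≡ 0` — with c5's T7
(`α ω₃ ≤ 0 ⇒ U ≡ 0`) the vertical vorticity of a nontrivial profile CHANGES SIGN unless its cyclonic tail is non-integrable;
(A2) if the vorticity avoids the OPEN co-rotation ball `B(αe₃, |α|)` (`2αω₃ ≤ |ω|²` everywhere) then `U ≡ 0` — the sphere
case left open by c5's `rotatedLerayProfile_vorticity_on_corotationSphere` is empty;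
(A3) every witness of stmt-16274 has vorticity STRICTLY inside `B(αe₃, |α|)` somewhere (`|ω|² < 2αω₃`: weak, nearly axial,
co-rotating), and `ω₃` changes sign or is non-integrable.
ENGINE: the `e₃`-component of the vorticity equation of the rotated profile (V1; the Coriolis term `αJω` is horizontal),
`Δω₃ − Dω₃[b] − ω₃ + DU[ω]₃ = 0` with `b = U + ½y − αJy`, in DIVERGENCE FORM (V2): `½ ω₃ = div F`,
`F := ω₃ b − ∇ω₃ − U₃ ω` (`div b = 3/2`, `div ω = 0`). The flux has `‖F‖/(1+|y|)` integrable as soon as `ω₃ ∈ L¹` (V3: the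
transport term `ω₃ b` grows like `|y| ω₃`), so the tree's `integral_divergence_eq_zero_of_integrable_div` gives `∫ ω₃ = 0`; a
signed continuous integrable `ω₃` with zero integral vanishes, and T7 ends the proof. On the co-rotation sphere
`ω₃ = |ω|²/(2α)` is signed AND `O(|y|⁻⁴)`, hence integrable (V3). -/

/-- **Tool stub V1 `stub_rotatedVorticityEq` (M; LANDED p170716, worker, `…RotatedVorticityEq.lean`) — the vorticity equation of a rotated Leray profile.** For a smooth solution of
`α(JU − DU[Jy]) + ½U + ½DU[y] − ΔU + DU[U] + ∇P = 0`, `div U = 0` (`J = rotGen`), the vorticity `ω = curl U` solves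
`Δω = Dω[U + ½y − αJy] + ω + αJω − DU[ω]`. Route 1: the rotating wave `(s,y) ↦ R(αs)U(R(−αs)y)` solves the backward Leray
system (`stub_corotatingFrame`, p148726, with `Rot = rotZLIE`), `IsBackwardLeraySolutionOn.vorticity_eq` at `s = 0`, where the
wave's vorticity is `R(αs)ω(R(−αs)y)` (rotation covariance of `curl`) and its `s`-derivative at `0` is `α(Jω − Dω[Jy])`
(`hasDerivAt_rotatingWave_zero`). Route 2: curl the system term by term (`curl_laplacian`, `curl_fderiv_apply_self`,
`curl_convect_self_of_isDivFree`, `curl_gradient_eq_zero_holds`, and `curl (JU − DU[Jy]) = Jω − Dω[Jy]`). -/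
theorem stub_rotatedVorticityEq {α : ℝ}
    {U : EuclideanSpace ℝ (Fin 3) → EuclideanSpace ℝ (Fin 3)} {P : EuclideanSpace ℝ (Fin 3) → ℝ}
    (hU : ContDiff ℝ (⊤ : ℕ∞) U) (hP : ContDiff ℝ (⊤ : ℕ∞) P) (hdiv : VectorCalculus.IsDivFree U)
    (heq : ∀ y : EuclideanSpace ℝ (Fin 3),
      α • (rotGen (U y) - fderiv ℝ U y (rotGen y)) + (1 / 2 : ℝ) • U y + (1 / 2 : ℝ) • fderiv ℝ U y y
        - (Δ U) y + fderiv ℝ U y (U y) + gradient P y = 0) :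
    ∀ y : EuclideanSpace ℝ (Fin 3),
      (Δ (curl U)) y = fderiv ℝ (curl U) y (U y + (1 / 2 : ℝ) • y - α • rotGen y) + curl U y
        + α • rotGen (curl U y) - fderiv ℝ U y (curl U y) :=
  Summit.NavierStokesRegularity.NavierStokesRegularity.Theorems.CorkscrewProfile.Birth.stub_rotatedVorticityEq hU hP hdiv heq

/-- **Tool stub V2 `stub_verticalVorticityDivergenceForm` (M; LANDED p170767, worker, `…VerticalVorticityDivergenceForm.lean`) — the vertical-vorticity flux, pure calculus.** For `U ∈ C³` with
`div U = 0` and any `α`, the flux `F := ω₃ b − ∇ω₃ − U₃ ω` (`ω = curl U`, `ω₃ = (curl U ·) 2`, `b = U + ½y − αJy`) has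
`div F = Dω[b]₃ + (3/2) ω₃ − (Δω)₃ − DU[ω]₃` (`div b = 3/2` from `div U = 0`, `div (½ id) = 3/2`, `div J = 0`
(`divergence_rotGen_eq_zero`); `div ∇f = Δf` for the coordinate function `f = ω₃`, and `(Δ ω)₃ = Δ(ω₃)`;
`div (U₃ ω) = DU[ω]₃` as `div curl = 0` (`divergence_curl_eq_zero_holds`); `divergence_smul_apply`). -/
theorem stub_verticalVorticityDivergenceForm {α : ℝ}
    {U : EuclideanSpace ℝ (Fin 3) → EuclideanSpace ℝ (Fin 3)} (hU : ContDiff ℝ 3 U)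
    (hdiv : VectorCalculus.IsDivFree U) (y : EuclideanSpace ℝ (Fin 3)) :
    VectorCalculus.divergence
        (fun z => (curl U z 2) • (U z + (1 / 2 : ℝ) • z - α • rotGen z)
          - gradient (fun w => curl U w 2) z - (U z 2) • curl U z) y =
      fderiv ℝ (curl U) y (U y + (1 / 2 : ℝ) • y - α • rotGen y) 2 + (3 / 2 : ℝ) * curl U y 2
        - (Δ (curl U)) y 2 - fderiv ℝ U y (curl U y) 2 :=
  Summit.NavierStokesRegularity.NavierStokesRegularity.Theorems.CorkscrewProfile.Birth.stub_verticalVorticityDivergenceForm hU hdiv y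

/-- **Tool stub V3 `stub_verticalVorticityFluxIntegrable` (S–M; LANDED p170889, worker, `…VerticalVorticityFluxIntegrable.lean`) — integrability under Type-I derivative decay.**
(a) On the co-rotation sphere `|ω|² = 2αω₃` (`α ≠ 0`) with `‖DU(y)‖ ≤ K/(1+‖y‖)²`:
`|ω₃| = |ω|²/(2|α|) ≤ ‖curlCLM‖² K² (2|α|)⁻¹ (1+‖y‖)⁻⁴` is integrable on `ℝ³` (`norm_curl_le`, `integrable_one_add_norm`,
continuity for measurability). (b) With `‖U‖ ≤ C₀/(1+‖y‖)`, `‖DU‖ ≤ K/(1+‖y‖)²`, `‖D curl U‖ ≤ K/(1+‖y‖)³` and `ω₃ ∈ L¹`: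
`‖F(y)‖/(1+‖y‖) ≤ (C₀ + ½ + |α|)|ω₃(y)| + K(1+‖y‖)⁻⁴ + ‖curlCLM‖ C₀ K (1+‖y‖)⁻⁴` (`‖Jy‖ ≤ ‖y‖`,
`‖∇ω₃‖ ≤ ‖D curl U‖`, `|U₃| ‖ω‖ ≤ C₀ ‖curlCLM‖ K (1+‖y‖)⁻³`), an integrable majorant; `F` is continuous for `U ∈ C³`. -/
theorem stub_verticalVorticityFluxIntegrable :
    (∀ (α K : ℝ) (U : EuclideanSpace ℝ (Fin 3) → EuclideanSpace ℝ (Fin 3)), α ≠ 0 → ContDiff ℝ 2 U →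
      (∀ y : EuclideanSpace ℝ (Fin 3), ‖fderiv ℝ U y‖ ≤ K / (1 + ‖y‖) ^ 2) →
      (∀ y : EuclideanSpace ℝ (Fin 3), ‖curl U y‖ ^ 2 = 2 * α * (curl U y) 2) →
      MeasureTheory.Integrable (fun y => curl U y 2)) ∧
    (∀ (α C₀ K : ℝ) (U : EuclideanSpace ℝ (Fin 3) → EuclideanSpace ℝ (Fin 3)), ContDiff ℝ 3 U →
      (∀ y : EuclideanSpace ℝ (Fin 3), ‖U y‖ ≤ C₀ / (1 + ‖y‖)) →
      (∀ y : EuclideanSpace ℝ (Fin 3), ‖fderiv ℝ U y‖ ≤ K / (1 + ‖y‖) ^ 2) →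
      (∀ y : EuclideanSpace ℝ (Fin 3), ‖fderiv ℝ (curl U) y‖ ≤ K / (1 + ‖y‖) ^ 3) →
      MeasureTheory.Integrable (fun y => curl U y 2) →
      MeasureTheory.Integrable (fun y : EuclideanSpace ℝ (Fin 3) =>
        ‖(curl U y 2) • (U y + (1 / 2 : ℝ) • y - α • rotGen y) - gradient (fun w => curl U w 2) y
            - (U y 2) • curl U y‖ / (1 + ‖y‖))) :=
  Summit.NavierStokesRegularity.NavierStokesRegularity.Theorems.CorkscrewProfile.Birth.stub_verticalVorticityFluxIntegrable

/-- **Tool stub V4 `stub_typeIDerivativeDecay` (M; LANDED p170693, worker, `…TypeIDerivativeDecay.lean`) — Type-I decay of the first two derivatives of a classical Type-I slice.**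
For a classical solution `(u, p)` of Navier–Stokes (`ν = 1`, `f = 0`) on `(−∞, 0)` with `‖u(t,x)‖ ≤ C₀/(‖x‖ + √−t)` and
`u(−1) ∈ C²`: `‖Du(−1)(x)‖ ≤ K/(1+‖x‖)²` and `‖D(curl u(−1))(x)‖ ≤ K/(1+‖x‖)³` for one `K ≥ 0`
(`exists_forall_iteratedFDeriv_le_of_typeI` for `n = 1, 2` at `t = −1`, where `max{‖x‖, √1} ≥ (1+‖x‖)/2`;
`‖iteratedFDeriv 1‖ = ‖fderiv‖`, `norm_fderiv_curl_le`; cf. `typeIPressureGrowth_derivs`). -/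
theorem stub_typeIDerivativeDecay {C₀ : ℝ}
    {u : ℝ → EuclideanSpace ℝ (Fin 3) → EuclideanSpace ℝ (Fin 3)} {p : ℝ → EuclideanSpace ℝ (Fin 3) → ℝ}
    (hsol : IsClassicalNSSolutionOn (Set.Iio 0) 1 0 u p)
    (hI : ∀ t ∈ Set.Iio (0 : ℝ), ∀ x : EuclideanSpace ℝ (Fin 3), ‖u t x‖ ≤ C₀ / (‖x‖ + Real.sqrt (-t)))
    (h2 : ContDiff ℝ 2 (u (-1))) :
    ∃ K : ℝ, 0 ≤ K ∧ ∀ x : EuclideanSpace ℝ (Fin 3),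
      ‖fderiv ℝ (u (-1)) x‖ ≤ K / (1 + ‖x‖) ^ 2 ∧ ‖fderiv ℝ (curl (u (-1))) x‖ ≤ K / (1 + ‖x‖) ^ 3 :=
  Summit.NavierStokesRegularity.NavierStokesRegularity.Theorems.CorkscrewProfile.Birth.stub_typeIDerivativeDecay hsol hI h2

/-- **Assembly A1 (lead; LANDED p171291, `…StrictCoRotation.lean`) `rotatedLerayProfile_eq_zero_of_cyclonic` — a CYCLONIC rotated Leray profile with integrable vertical
vorticity is trivial.** Smooth `(U, P)` solving the rotated profile system, profile Type-I decay, polynomial pressure, Type-I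
derivative decay, `ω₃ ∈ L¹` and `α ω₃ ≥ 0` everywhere force `U ≡ 0` (V1+V2: `div F = ½ω₃`; V3(b) +
`integral_divergence_eq_zero_of_integrable_div`: `∫ ω₃ = 0`; so `α ω₃ ≡ 0`; T7 with polynomial pressure). -/
theorem rotatedLerayProfile_eq_zero_of_cyclonic {α C₀ M K : ℝ} {N : ℕ}
    {U : EuclideanSpace ℝ (Fin 3) → EuclideanSpace ℝ (Fin 3)} {P : EuclideanSpace ℝ (Fin 3) → ℝ}
    (hU : ContDiff ℝ (⊤ : ℕ∞) U) (hP : ContDiff ℝ (⊤ : ℕ∞) P) (hdiv : VectorCalculus.IsDivFree U)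
    (heq : ∀ y : EuclideanSpace ℝ (Fin 3),
      α • (rotGen (U y) - fderiv ℝ U y (rotGen y)) + (1 / 2 : ℝ) • U y + (1 / 2 : ℝ) • fderiv ℝ U y y
        - (Δ U) y + fderiv ℝ U y (U y) + gradient P y = 0)
    (hdec : ∀ y : EuclideanSpace ℝ (Fin 3), ‖U y‖ ≤ C₀ / (1 + ‖y‖))
    (hPM : ∀ y : EuclideanSpace ℝ (Fin 3), |P y| ≤ M * (1 + ‖y‖) ^ N)
    (hD1 : ∀ y : EuclideanSpace ℝ (Fin 3), ‖fderiv ℝ U y‖ ≤ K / (1 + ‖y‖) ^ 2)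
    (hD2 : ∀ y : EuclideanSpace ℝ (Fin 3), ‖fderiv ℝ (curl U) y‖ ≤ K / (1 + ‖y‖) ^ 3)
    (hint : MeasureTheory.Integrable (fun y => curl U y 2))
    (hsign : ∀ y : EuclideanSpace ℝ (Fin 3), 0 ≤ α * (curl U y) 2) : U = 0 :=
  Summit.NavierStokesRegularity.NavierStokesRegularity.Theorems.CorkscrewProfile.Birth.rotatedLerayProfile_eq_zero_of_cyclonic hU hP hdiv heq hdec hPM hD1 hD2 hint hsign

/-- **Assembly A2 (lead; LANDED p171291) `rotatedLerayProfile_eq_zero_of_offBall` — vorticity avoiding the OPEN co-rotation ball forces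
triviality.** Same data; if `2α ω₃ ≤ |ω|²` everywhere (the vorticity never enters the open ball `B(αe₃, |α|)`) then `U ≡ 0`
(`α = 0`: T7; `α ≠ 0`: the gauged head is constant and `|ω|² ≡ 2αω₃` — c5's sphere rigidity with polynomial pressure —, so
`ω₃` is cyclonic and integrable (V3(a)), and A1 applies). Closes the sphere case of `rotatedLerayProfile_vorticity_on_corotationSphere`. -/
theorem rotatedLerayProfile_eq_zero_of_offBall {α C₀ M K : ℝ} {N : ℕ}
    {U : EuclideanSpace ℝ (Fin 3) → EuclideanSpace ℝ (Fin 3)} {P : EuclideanSpace ℝ (Fin 3) → ℝ}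
    (hU : ContDiff ℝ (⊤ : ℕ∞) U) (hP : ContDiff ℝ (⊤ : ℕ∞) P) (hdiv : VectorCalculus.IsDivFree U)
    (heq : ∀ y : EuclideanSpace ℝ (Fin 3),
      α • (rotGen (U y) - fderiv ℝ U y (rotGen y)) + (1 / 2 : ℝ) • U y + (1 / 2 : ℝ) • fderiv ℝ U y y
        - (Δ U) y + fderiv ℝ U y (U y) + gradient P y = 0)
    (hdec : ∀ y : EuclideanSpace ℝ (Fin 3), ‖U y‖ ≤ C₀ / (1 + ‖y‖))
    (hPM : ∀ y : EuclideanSpace ℝ (Fin 3), |P y| ≤ M * (1 + ‖y‖) ^ N)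
    (hD1 : ∀ y : EuclideanSpace ℝ (Fin 3), ‖fderiv ℝ U y‖ ≤ K / (1 + ‖y‖) ^ 2)
    (hD2 : ∀ y : EuclideanSpace ℝ (Fin 3), ‖fderiv ℝ (curl U) y‖ ≤ K / (1 + ‖y‖) ^ 3)
    (hball : ∀ y : EuclideanSpace ℝ (Fin 3), 2 * α * (curl U y) 2 ≤ ‖curl U y‖ ^ 2) : U = 0 :=
  Summit.NavierStokesRegularity.NavierStokesRegularity.Theorems.CorkscrewProfile.Birth.rotatedLerayProfile_eq_zero_of_offBall hU hP hdiv heq hdec hPM hD1 hD2 hball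

/-- **Assembly A3 (lead; LANDED p171291) `rssProfileExists_enters_corotationBall` — every RSS profile enters the open co-rotation ball and its
vertical vorticity changes sign or has a non-integrable (cyclonic) tail.** `RssProfileExists` (stmt-16274) implies: the rotated
Leray profile `(U, P)` of T11 has, besides a co-rotating point, a point with `|curl U|² < 2α (curl U)₃` (vorticity STRICTLY
inside `B(αe₃, |α|)`), and either a point with `α (curl U)₃ < 0` or `(curl U)₃ ∉ L¹(ℝ³)` (T10 + V4 supply the derivative
decay of the slice `U = V(−1)`; A1, A2). -/
theorem rssProfileExists_enters_corotationBall
    (h : Summit.NavierStokesRegularity.NavierStokesRegularity.Theses.FilamentSkeletonRss.RssProfileExists) :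
    ∃ (α C₀ M : ℝ) (N : ℕ) (U : EuclideanSpace ℝ (Fin 3) → EuclideanSpace ℝ (Fin 3)) (P : EuclideanSpace ℝ (Fin 3) → ℝ),
      α ≠ 0 ∧ U ≠ 0 ∧ ContDiff ℝ (⊤ : ℕ∞) U ∧ ContDiff ℝ (⊤ : ℕ∞) P ∧ VectorCalculus.IsDivFree U ∧
      (∀ y : EuclideanSpace ℝ (Fin 3),
        α • (rotGen (U y) - fderiv ℝ U y (rotGen y)) + (1 / 2 : ℝ) • U y + (1 / 2 : ℝ) • fderiv ℝ U y y
          - (Δ U) y + fderiv ℝ U y (U y) + gradient P y = 0) ∧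
      (∀ y : EuclideanSpace ℝ (Fin 3), ‖U y‖ ≤ C₀ / (1 + ‖y‖)) ∧
      (∀ y : EuclideanSpace ℝ (Fin 3), |P y| ≤ M * (1 + ‖y‖) ^ N) ∧
      (∃ y : EuclideanSpace ℝ (Fin 3), ‖curl U y‖ ^ 2 < 2 * α * (curl U y) 2) ∧
      ((∃ y : EuclideanSpace ℝ (Fin 3), α * (curl U y) 2 < 0) ∨ ¬ MeasureTheory.Integrable (fun y => curl U y 2)) :=
  Summit.NavierStokesRegularity.NavierStokesRegularity.Theorems.CorkscrewProfile.Birth.rssProfileExists_enters_corotationBall h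

/-! #### Wave 2 of lead c6 (registered v14) — the GAUSSIAN ANGULAR-MOMENTUM IDENTITY of a rotated Leray profile

The same flux identity integrated against the Gaussian weight `G = e^{−|y|²/4}` (for which `Δ − ½y·∇` is symmetric, so NO
decay at infinity is needed — every term converges for polynomially bounded fields): for EVERY smooth rotated Leray profile
(any `α`, Leray's `α = 0` included) with polynomially bounded `U`, `DU`, `D curl U`,

  `∫ G ⟪Jy, U⟫ = ∫ G ⟪Jy, U × curl U⟫`

— the Gaussian angular momentum about the rotation axis equals the Gaussian torque of the Lamb vector (`2∫Gω₃ = ∫G⟪Jy, U⟫`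
because `ω₃ = −div(JU)`, and `2∫Gω₃ = ∫G⟪Jy, U × ω⟫` from `½ω₃ = div F` and `∫G div F = ½∫G⟪y, F⟫`; the rotation forcing
has zero Gaussian torque about its own axis, which is why `α` drops out). Tool stubs: W1 `stub_gaussianDivergenceIBP`,
W2 `stub_gaussianPolyIntegrable`; assembly W3 `gaussian_angularMomentum_eq_lambTorque` (lead). -/

/-- **Tool stub W1 `stub_gaussianDivergenceIBP` (S–M; LANDED p171087, worker, `…GaussianDivergenceIBP.lean`) — Gaussian integration by parts for a divergence.** For a `C¹` field
`F` on a finite-dimensional inner product space with `G•F`, `G div F` and `G⟪y, F⟫` integrable (`G(y) = e^{−‖y‖²/4}`,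
`∇G = −½ G y`): `∫ G div F = ½ ∫ G ⟪y, F⟫` (`div (G•F) = G div F + ⟪F, ∇G⟫`, `divergence_smul_apply`,
`fderiv_gaussianWeightFun_apply`/`hasFDerivAt_gaussianWeightFun`, and `integral_divergence_eq_zero_of_integrable` for `G•F`). -/
theorem stub_gaussianDivergenceIBP [MeasurableSpace E] [BorelSpace E] {F : E → E} (hF : ContDiff ℝ 1 F)
    (hGF : MeasureTheory.Integrable (fun y => Real.exp (-‖y‖ ^ 2 / 4) • F y))
    (hGdiv : MeasureTheory.Integrable (fun y => Real.exp (-‖y‖ ^ 2 / 4) * VectorCalculus.divergence F y))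
    (hGyF : MeasureTheory.Integrable (fun y => Real.exp (-‖y‖ ^ 2 / 4) * ⟪y, F y⟫)) :
    ∫ y, Real.exp (-‖y‖ ^ 2 / 4) * VectorCalculus.divergence F y =
      (1 / 2 : ℝ) * ∫ y, Real.exp (-‖y‖ ^ 2 / 4) * ⟪y, F y⟫ :=
  Summit.NavierStokesRegularity.NavierStokesRegularity.Theorems.CorkscrewProfile.Birth.stub_gaussianDivergenceIBP hF hGF hGdiv hGyF

/-- **Tool stub W2 `stub_gaussianPolyIntegrable` (S; LANDED p171103, worker, `…GaussianPolyIntegrable.lean`) — Gaussian times polynomial growth is integrable.** On a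
finite-dimensional inner product space, an a.e.-strongly measurable `f` with `‖f y‖ ≤ C(1+‖y‖)^N` has `G • f ∈ L¹`
(`G(y) = e^{−‖y‖²/4}`; e.g. `(1+‖y‖)^N e^{−‖y‖²/8}` is bounded and `e^{−‖y‖²/8}` is integrable — Mathlib
`integrable_exp_neg_mul_sq_norm`-type lemmas / the tree's `integrable_pow_mul_gaussian`, `integrable_norm_mul_gaussian`). -/
theorem stub_gaussianPolyIntegrable [MeasurableSpace E] [BorelSpace E]
    {F' : Type*} [NormedAddCommGroup F'] [NormedSpace ℝ F'] {f : E → F'} {C : ℝ} {N : ℕ}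
    (hf : MeasureTheory.AEStronglyMeasurable f MeasureTheory.volume)
    (hb : ∀ y, ‖f y‖ ≤ C * (1 + ‖y‖) ^ N) :
    MeasureTheory.Integrable (fun y => Real.exp (-‖y‖ ^ 2 / 4) • f y) :=
  Summit.NavierStokesRegularity.NavierStokesRegularity.Theorems.CorkscrewProfile.Birth.stub_gaussianPolyIntegrable hf hb

/-- **Assembly W3 (worker; LANDED p171631 `…GaussianAngularMomentum.lean` + tools p171411) `gaussian_angularMomentum_eq_lambTorque` — the Gaussian angular-momentum identity.** For a smooth
solution of Perelman's rotated Leray profile system (any `α ∈ ℝ`) with polynomially bounded `U`, `DU`, `D curl U`: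
`∫ e^{−|y|²/4} ⟪Jy, U⟫ dy = ∫ e^{−|y|²/4} ⟪Jy, U × curl U⟫ dy` (W1 applied to `F = ω₃ b − ∇ω₃ − U₃ ω`
(`div F = ½ω₃`, `divergence_verticalVorticityFlux`), to `ω₃ • y` and to `J ∘ U` (`div (JU) = −ω₃`); W2 for every
integrability; `⟪y, Jy⟫ = 0`, `U₃⟪y, ω⟫ − ω₃⟪y, U⟫ = ⟪Jy, U × ω⟫`). -/
theorem gaussian_angularMomentum_eq_lambTorque {α K : ℝ} {N : ℕ}
    {U : EuclideanSpace ℝ (Fin 3) → EuclideanSpace ℝ (Fin 3)} {P : EuclideanSpace ℝ (Fin 3) → ℝ}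
    (hU : ContDiff ℝ (⊤ : ℕ∞) U) (hP : ContDiff ℝ (⊤ : ℕ∞) P) (hdiv : VectorCalculus.IsDivFree U)
    (heq : ∀ y : EuclideanSpace ℝ (Fin 3),
      α • (rotGen (U y) - fderiv ℝ U y (rotGen y)) + (1 / 2 : ℝ) • U y + (1 / 2 : ℝ) • fderiv ℝ U y y
        - (Δ U) y + fderiv ℝ U y (U y) + gradient P y = 0)
    (hUb : ∀ y : EuclideanSpace ℝ (Fin 3), ‖U y‖ ≤ K * (1 + ‖y‖) ^ N)
    (hD1 : ∀ y : EuclideanSpace ℝ (Fin 3), ‖fderiv ℝ U y‖ ≤ K * (1 + ‖y‖) ^ N)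
    (hD2 : ∀ y : EuclideanSpace ℝ (Fin 3), ‖fderiv ℝ (curl U) y‖ ≤ K * (1 + ‖y‖) ^ N) :
    ∫ y, Real.exp (-‖y‖ ^ 2 / 4) * ⟪rotGen y, U y⟫ =
      ∫ y, Real.exp (-‖y‖ ^ 2 / 4) * ⟪rotGen y, cross (U y) (curl U y)⟫ :=
  Summit.NavierStokesRegularity.NavierStokesRegularity.Theorems.CorkscrewProfile.Birth.gaussian_angularMomentum_eq_lambTorque hU hP hdiv heq hUb hD1 hD2


end RotationGaugedHead

/-! ### Tool stubs of lead c7 — STRETCHING NECESSITY (registered v17)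

THEOREM (target of this block). In backward similarity variables the vorticity `Ω = (−t) ω` of an ancient solution is DAMPED at
unit rate (the dilution tax of the route text: `curl(½y × Ω) = −Ω − ½y·∇Ω`); only vortex stretching can pay for it. Precisely:
(B, parabolic) a classical Navier–Stokes solution on `ℝ³ × (−∞,0)` with the Type-I bound `|u| ≤ C₀/(|x| + √−t)` whose stretching
rate is SUBCRITICAL, `(−t) ⟪ω, ∇u ω⟫ ≤ Λ |ω|²` everywhere for some `Λ < 1`, is identically zero: by Pineau–Vicol's Lemma 7.1
`|∇u| ≤ K / max(|x|, √−t)² ≤ K/(−t)`, so `w = (−t)^{2Λ} |ω|²` is bounded by `b(t) = c K² (−t)^{2Λ−2} → 0` (`t → −∞`) and is a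
SUBSOLUTION of the drift–heat equation `∂ₜw ≤ Δw − u·∇w` (the transport identity
`∂ₜ|ω|² = Δ|ω|² − u·∇|ω|² + 2⟪ω, ∇u ω⟫ − 2|∇ω|²`); the weak maximum principle on `B_R × [t₀, t₁]` with the barrier
`b(t₀) + ε e^{μ(t−t₀)}(1 + |x|²)`, `μ = 7 + C₀²/(−t₁)`, gives `w(t₁, x₁) ≤ b(t₀)`, and `t₀ → −∞` kills `w`; a curl-free
divergence-free slice with Type-I decay vanishes. Hence EVERY corkscrew (indeed every nontrivial Type-I ancient mild solution in
the Oseen gauge) has, for every `Λ < 1`, a point with `(−t)⟪ω, ∇u ω⟫ > Λ|ω|²` — it stretches some vortex line at least at the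
self-similar clock rate, `sup (−t) σ ≥ 1` — and these points lie in the parabolic core `|x|² ≤ (K/Λ)(−t)`.
(A, elliptic, sharper for the open stub) a smooth rotated Leray profile (the RSS profile of a witness of stmt-16274, any `α`) with
`⟪ω, DU ω⟫ ≤ |ω|²` EVERYWHERE (non-strict) is trivial: by V1, `Θ = |ω|²` satisfies
`ΔΘ − DΘ[U + ½y − αJy] = 2|Dω|² + 2(|ω|² − ⟪ω, DU ω⟫) ≥ 0`, a bounded subsolution of the co-rotating drift operator, hence
constant (T1 `stub_skewDriftLiouville`), hence `0` by the derivative decay; so a witness of stmt-16274 has a point where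
`⟪ω, DU ω⟫ > |ω|²`. Both are necessary conditions on the crux's objects complementary to c5/c6 (WHERE the vorticity points:
inside the co-rotation ball) — here HOW HARD it is stretched. -/

section StretchingNecessity

open Literature.Analysis.FluidPDE Literature.Analysis.FluidPDE.PineauVicol2026
open scoped RealInnerProductSpace Laplacian

/-- **Tool stub S1 `stub_subcriticalStretchingSteady` (M; LANDED p173219 `…SubcriticalStretchingSteady.lean`) — subcritical stretching kills a rotated Leray profile.** A smooth
divergence-free solution `(U, P)` of Perelman's rotated Leray profile system (any `α`) with the profile Type-I decay
`‖U y‖ ≤ C₀/(1+‖y‖)`, the derivative decay `‖DU y‖ ≤ K/(1+‖y‖)²`, and `⟪curl U, DU (curl U)⟫ ≤ |curl U|²` EVERYWHERE is trivial.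
Sketch: `Θ y = ‖curl U y‖²` is `C²`, bounded by `(‖curlCLM‖ K)²`; by V1 (`stub_rotatedVorticityEq`), `laplacian_inner_self_eq`
and `fderiv_inner_self_apply`, `driftOp 1 ½ (U − αJ) Θ = ΔΘ − DΘ[U + ½y − αJy] = 2 frobeniusNormSq (D curl U) + 2(Θ − ⟪ω, DU ω⟫) ≥ 0`
(`⟪Jω, ω⟫ = 0`); T1 (`stub_skewDriftLiouville`, `ν = 1`, `a = ½`, `b = 0`, `S = α • rotGenL`) makes `Θ` constant; `Θ → 0` along
`‖y‖ → ∞` (`Θ ≤ (‖curlCLM‖ K)²/(1+‖y‖)⁴`), so `curl U ≡ 0` and `eq_zero_of_curl_eq_zero_of_isDivFree_of_norm_le` ends. -/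
theorem stub_subcriticalStretchingSteady {α C₀ K : ℝ}
    {U : EuclideanSpace ℝ (Fin 3) → EuclideanSpace ℝ (Fin 3)} {P : EuclideanSpace ℝ (Fin 3) → ℝ}
    (hU : ContDiff ℝ (⊤ : ℕ∞) U) (hP : ContDiff ℝ (⊤ : ℕ∞) P) (hdiv : VectorCalculus.IsDivFree U)
    (heq : ∀ y : EuclideanSpace ℝ (Fin 3),
      α • (rotGen (U y) - fderiv ℝ U y (rotGen y)) + (1 / 2 : ℝ) • U y + (1 / 2 : ℝ) • fderiv ℝ U y y
        - (Δ U) y + fderiv ℝ U y (U y) + gradient P y = 0)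
    (hdec : ∀ y : EuclideanSpace ℝ (Fin 3), ‖U y‖ ≤ C₀ / (1 + ‖y‖))
    (hD1 : ∀ y : EuclideanSpace ℝ (Fin 3), ‖fderiv ℝ U y‖ ≤ K / (1 + ‖y‖) ^ 2)
    (hstretch : ∀ y : EuclideanSpace ℝ (Fin 3), ⟪curl U y, fderiv ℝ U y (curl U y)⟫ ≤ ‖curl U y‖ ^ 2) :
    U = 0 :=
  Summit.NavierStokesRegularity.NavierStokesRegularity.Theorems.CorkscrewProfile.Birth.stub_subcriticalStretchingSteady hU hP hdiv heq hdec hD1 hstretch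

/-- **Tool stub S2 `stub_vorticitySqTransport` (M; LANDED p173450 `…VorticitySqTransport.lean`) — the transport identity of `|ω|²`.** For a classical Navier–Stokes solution
(`ν = 1`, zero force) on `(−∞, 0)`, `φ(t, x) = ‖curl u(t)(x)‖²` has `C²` slices, is jointly continuous on `(−∞,0) × ℝ³`, and is
differentiable in time with `∂ₜφ = Δφ − Dφ[u] + 2⟪ω, Du[ω]⟫ − 2‖Dω‖²_F` (vorticity equation
`∂ₜω + (u·∇)ω = (ω·∇)u + Δω`, `IsClassicalNSSolutionOn.vorticity_eq` on the open set `Iio 0`; `Δ‖ω‖² = 2⟪Δω, ω⟫ + 2‖Dω‖²_F`,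
`laplacian_inner_self_eq`; `D‖ω‖²[v] = 2⟪ω, Dω v⟫`; joint smoothness `IsSmoothSpaceTimeOn` of the vorticity). -/
theorem stub_vorticitySqTransport
    {u : ℝ → EuclideanSpace ℝ (Fin 3) → EuclideanSpace ℝ (Fin 3)} {p : ℝ → EuclideanSpace ℝ (Fin 3) → ℝ}
    (hsol : IsClassicalNSSolutionOn (Set.Iio 0) 1 0 u p) :
    (∀ t < 0, ContDiff ℝ 2 (fun x => ‖curl (u t) x‖ ^ 2)) ∧
    ContinuousOn (Function.uncurry fun t x => ‖curl (u t) x‖ ^ 2) (Set.Iio 0 ×ˢ Set.univ) ∧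
    ∀ t < 0, ∀ x : EuclideanSpace ℝ (Fin 3), HasDerivAt (fun s => ‖curl (u s) x‖ ^ 2)
      ((Δ (fun y => ‖curl (u t) y‖ ^ 2)) x - fderiv ℝ (fun y => ‖curl (u t) y‖ ^ 2) x (u t x)
        + 2 * ⟪curl (u t) x, fderiv ℝ (u t) x (curl (u t) x)⟫
        - 2 * frobeniusNormSq (fderiv ℝ (curl (u t)) x)) t :=
  Summit.NavierStokesRegularity.NavierStokesRegularity.Theorems.CorkscrewProfile.Birth.stub_vorticitySqTransport hsol

/-- **Tool stub S3 `stub_ancientSubsolutionNonpos` (M/L; LANDED p173670 `…AncientSubsolutionLiouville.lean`) — ancient subsolutions die.** Let `w` have `C²` slices, be jointly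
continuous on `(−∞,0) × ℝ³`, differentiable in time, and satisfy the differential inequality `∂ₜw ≤ Δw − Dw[V]` with a drift
obeying the Type-I bound `‖V(t, x)‖ ≤ C₀/√(−t)`; if `w(t, x) ≤ b(t)` with `b` monotone on `(−∞, 0)` and `b(t) → 0` as `t → −∞`,
then `w ≤ 0`. Sketch (as `tangentDrift_le_barrier`/`tangentDrift_nonpos` of `…SphereTangentLiouvilleMaxPrinciple`): on
`closedBall 0 R × [t₀, t₁]` compare `w` with `B = b(t₀) + ε e^{μ(t−t₀)}(1+|x|²)`, `μ = 7 + M²`, `M = C₀/√(−t₁)`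
(`(∂ₜ − Δ + V·∇)(1+|x|²) = −6 + 2⟪V, x⟫ ≥ −(7 + M²)(1+|x|²)`; `contDiff_barrier`, `laplacian_barrier`, `hasFDerivAt_barrier`,
`weak_max_principle`), `R² ≥ (b t₁ − b t₀)/ε`; get `w(t₁,x₁) ≤ b(t₀) + ε e^{μ(t₁−t₀)}(1+|x₁|²)`; `ε → 0`, then `t₀ → −∞`. -/
theorem stub_ancientSubsolutionNonpos {w wt : ℝ → EuclideanSpace ℝ (Fin 3) → ℝ}
    {V : ℝ → EuclideanSpace ℝ (Fin 3) → EuclideanSpace ℝ (Fin 3)} {C₀ : ℝ} {b : ℝ → ℝ}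
    (hw2 : ∀ t < 0, ContDiff ℝ 2 (w t))
    (hwc : ContinuousOn (Function.uncurry w) (Set.Iio 0 ×ˢ Set.univ))
    (hwt : ∀ t < 0, ∀ x, HasDerivAt (fun s => w s x) (wt t x) t)
    (hsub : ∀ t < 0, ∀ x, wt t x ≤ (Δ (w t)) x - fderiv ℝ (w t) x (V t x))
    (hV : ∀ t < 0, ∀ x, ‖V t x‖ ≤ C₀ / Real.sqrt (-t))
    (hbd : ∀ t < 0, ∀ x, w t x ≤ b t)
    (hb : MonotoneOn b (Set.Iio 0))
    (hb0 : Filter.Tendsto b Filter.atBot (nhds 0)) :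
    ∀ t < 0, ∀ x, w t x ≤ 0 :=
  Summit.NavierStokesRegularity.NavierStokesRegularity.Theorems.CorkscrewProfile.Birth.stub_ancientSubsolutionNonpos hw2 hwc hwt hsub hV hbd hb hb0

/-- **Tool stub S4 `stub_typeIGradientBound` (S; LANDED p173764 `…TypeIGradientBound.lean`) — the Type-I gradient bound.** A classical Navier–Stokes solution on `(−∞,0)`
with `‖u(t,x)‖ ≤ C₀/(‖x‖ + √(−t))` has `‖Du(t)(x)‖ ≤ K / max(‖x‖, √(−t))²` for all `t < 0`, `x`
(`PineauVicol2026.exists_forall_iteratedFDeriv_le_of_typeI` with `n = 1`, `‖iteratedFDeriv ℝ 1 f x‖ = ‖fderiv ℝ f x‖`). -/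
theorem stub_typeIGradientBound {C₀ : ℝ}
    {u : ℝ → EuclideanSpace ℝ (Fin 3) → EuclideanSpace ℝ (Fin 3)} {p : ℝ → EuclideanSpace ℝ (Fin 3) → ℝ}
    (hsol : IsClassicalNSSolutionOn (Set.Iio 0) 1 0 u p)
    (hI : ∀ t < 0, ∀ x, ‖u t x‖ ≤ C₀ / (‖x‖ + Real.sqrt (-t))) :
    ∃ K : ℝ, 0 ≤ K ∧ ∀ t < 0, ∀ x : EuclideanSpace ℝ (Fin 3),
      ‖fderiv ℝ (u t) x‖ ≤ K / (max ‖x‖ (Real.sqrt (-t))) ^ 2 :=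
  Summit.NavierStokesRegularity.NavierStokesRegularity.Theorems.CorkscrewProfile.Birth.stub_typeIGradientBound hsol hI

/-- **Assembly B (lead c7; LANDED p173937 `…StretchingNecessity.lean`) `typeI_vorticity_eq_zero_of_subcritical_stretching` — SUBCRITICAL STRETCHING KILLS TYPE-I ANCIENT
VORTICITY.** A classical Navier–Stokes solution on `ℝ³ × (−∞, 0)` with the Type-I bound `‖u(t,x)‖ ≤ C₀/(‖x‖ + √(−t))` and
`(−t) ⟪ω, Du ω⟫ ≤ Λ ‖ω‖²` everywhere for some `Λ < 1` is irrotational (S2 + S4: `(−t)^{2Λ}‖ω‖²` is a subsolution bounded by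
`(‖curlCLM‖ K)² (−t)^{2Λ−2}`; S3). -/
theorem typeI_vorticity_eq_zero_of_subcritical_stretching {C₀ Λ : ℝ}
    {u : ℝ → EuclideanSpace ℝ (Fin 3) → EuclideanSpace ℝ (Fin 3)} {p : ℝ → EuclideanSpace ℝ (Fin 3) → ℝ}
    (hsol : IsClassicalNSSolutionOn (Set.Iio 0) 1 0 u p)
    (hI : ∀ t < 0, ∀ x, ‖u t x‖ ≤ C₀ / (‖x‖ + Real.sqrt (-t))) (hΛ : Λ < 1)
    (hstretch : ∀ t < 0, ∀ x : EuclideanSpace ℝ (Fin 3),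
      (-t) * ⟪curl (u t) x, fderiv ℝ (u t) x (curl (u t) x)⟫ ≤ Λ * ‖curl (u t) x‖ ^ 2) :
    ∀ t < 0, ∀ x, curl (u t) x = 0 :=
  Summit.NavierStokesRegularity.NavierStokesRegularity.Theorems.CorkscrewProfile.Birth.typeI_vorticity_eq_zero_of_subcritical_stretching hsol hI hΛ hstretch

/-- **Assembly B′ (lead c7; LANDED p173937) `typeI_eq_zero_of_subcritical_stretching` — the Liouville theorem.** Under the hypotheses of
`typeI_vorticity_eq_zero_of_subcritical_stretching` the solution vanishes on the past: each slice is curl-free, divergence-free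
and `O(1/|x|)` (`eq_zero_of_curl_eq_zero_of_isDivFree_of_norm_le`). -/
theorem typeI_eq_zero_of_subcritical_stretching {C₀ Λ : ℝ}
    {u : ℝ → EuclideanSpace ℝ (Fin 3) → EuclideanSpace ℝ (Fin 3)} {p : ℝ → EuclideanSpace ℝ (Fin 3) → ℝ}
    (hsol : IsClassicalNSSolutionOn (Set.Iio 0) 1 0 u p)
    (hI : ∀ t < 0, ∀ x, ‖u t x‖ ≤ C₀ / (‖x‖ + Real.sqrt (-t))) (hΛ : Λ < 1)
    (hstretch : ∀ t < 0, ∀ x : EuclideanSpace ℝ (Fin 3),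
      (-t) * ⟪curl (u t) x, fderiv ℝ (u t) x (curl (u t) x)⟫ ≤ Λ * ‖curl (u t) x‖ ^ 2) :
    ∀ t < 0, u t = 0 :=
  Summit.NavierStokesRegularity.NavierStokesRegularity.Theorems.CorkscrewProfile.Birth.typeI_eq_zero_of_subcritical_stretching hsol hI hΛ hstretch

/-- **Corollary (lead c7) `exists_supercritical_stretching_of_ne_zero` — Type-I ancient flows stretch at the self-similar rate.**
A classical Type-I solution on `(−∞,0)` which is nonzero at some negative time has, for every `Λ < 1`, a point with
`Λ‖ω‖² < (−t)⟪ω, Du ω⟫` (so `sup (−t) σ ≥ 1` for the stretching rate `σ = ⟪ω̂, S ω̂⟫`). -/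
theorem exists_supercritical_stretching_of_ne_zero {C₀ Λ : ℝ}
    {u : ℝ → EuclideanSpace ℝ (Fin 3) → EuclideanSpace ℝ (Fin 3)} {p : ℝ → EuclideanSpace ℝ (Fin 3) → ℝ}
    (hsol : IsClassicalNSSolutionOn (Set.Iio 0) 1 0 u p)
    (hI : ∀ t < 0, ∀ x, ‖u t x‖ ≤ C₀ / (‖x‖ + Real.sqrt (-t))) (hne : ∃ t < 0, u t ≠ 0) (hΛ : Λ < 1) :
    ∃ t < 0, ∃ x : EuclideanSpace ℝ (Fin 3),
      Λ * ‖curl (u t) x‖ ^ 2 < (-t) * ⟪curl (u t) x, fderiv ℝ (u t) x (curl (u t) x)⟫ := by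
  by_contra h
  push Not at h
  obtain ⟨t, ht, hut⟩ := hne
  exact hut (typeI_eq_zero_of_subcritical_stretching hsol hI hΛ h t ht)

/-- **Corollary (lead c7) `typeIAncientMild_supercritical_stretching` — the Oseen-gauge form.** A nontrivial Type-I ancient mild
solution in the Oseen gauge (`IsTypeIAncientMild C₀ V`, classical on `(−∞,0)` by
`exists_isClassicalNSSolutionOn_Iio_of_isTypeIAncientMild`) with the Type-I decay `HasTypeIDecay C₀ V` has supercritical
stretching points for every `Λ < 1`. -/
theorem typeIAncientMild_supercritical_stretching {C₀ Λ : ℝ}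
    {V : ℝ → EuclideanSpace ℝ (Fin 3) → EuclideanSpace ℝ (Fin 3)}
    (hV : IsTypeIAncientMild C₀ V) (hdec : HasTypeIDecay C₀ V) (hne : ∃ t < 0, V t ≠ 0) (hΛ : Λ < 1) :
    ∃ t < 0, ∃ x : EuclideanSpace ℝ (Fin 3),
      Λ * ‖curl (V t) x‖ ^ 2 < (-t) * ⟪curl (V t) x, fderiv ℝ (V t) x (curl (V t) x)⟫ := by
  obtain ⟨q, hcl⟩ :=
    Summit.NavierStokesRegularity.NavierStokesRegularity.Theorems.PolyhedralDssProfileExists.PolyhedralCell.exists_isClassicalNSSolutionOn_Iio_of_isTypeIAncientMild hV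
  exact exists_supercritical_stretching_of_ne_zero hcl (fun t ht x => hdec t ht x) hne hΛ

/-- **Corollary (lead c7) `corkscrewProfile_supercritical_stretching` — EVERY CORKSCREW STRETCHES SUPERCRITICALLY.** If the crux
holds, its Oseen-gauge normal form (`corkscrewProfile_iff_smooth`) is a nontrivial Type-I ancient mild solution, rotated `c`-DSS about
`e₃`, which for every `Λ < 1` has a point with `Λ‖ω‖² < (−t)⟪ω, DV ω⟫`. -/
theorem corkscrewProfile_supercritical_stretching
    (h : Summit.NavierStokesRegularity.NavierStokesRegularity.Theses.CorkscrewDynamo.CorkscrewProfile) :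
    ∃ (c θ C₀ : ℝ) (V : ℝ → EuclideanSpace ℝ (Fin 3) → EuclideanSpace ℝ (Fin 3)), 1 < c ∧
      IsTypeIAncientMild C₀ V ∧ IsRotatedDSS c (rotZLIE θ) V ∧ HasTypeIDecay C₀ V ∧
      (∃ t < 0, ∃ x, rotZ θ (V t (rotZ (-θ) x)) ≠ V t x) ∧
      ∀ Λ < 1, ∃ t < 0, ∃ x : EuclideanSpace ℝ (Fin 3),
        Λ * ‖curl (V t) x‖ ^ 2 < (-t) * ⟪curl (V t) x, fderiv ℝ (V t) x (curl (V t) x)⟫ := by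
  obtain ⟨c, θ, C₀, V, hc, hV, hdss, hdec, t, ht, x, hx⟩ := corkscrewProfile_iff_smooth.1 h
  have hne : ∃ t < 0, V t ≠ 0 := by
    refine ⟨t, ht, fun h0 => hx ?_⟩
    have hz : rotZ θ (0 : EuclideanSpace ℝ (Fin 3)) = 0 := by
      ext i
      fin_cases i <;> simp
    simp [h0, hz]
  exact ⟨c, θ, C₀, V, hc, hV, hdss, hdec, ⟨t, ht, x, hx⟩,
    fun Λ hΛ => typeIAncientMild_supercritical_stretching hV hdec hne hΛ⟩

/-- **Corollary A (lead c7) `exists_supercritical_stretching_steady` — a nontrivial rotated Leray profile stretches supercritically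
somewhere** (contrapositive of S1): under the data of S1 with `U ≠ 0` there is a point with `‖curl U‖² < ⟪curl U, DU (curl U)⟫`. -/
theorem exists_supercritical_stretching_steady {α C₀ K : ℝ}
    {U : EuclideanSpace ℝ (Fin 3) → EuclideanSpace ℝ (Fin 3)} {P : EuclideanSpace ℝ (Fin 3) → ℝ}
    (hU : ContDiff ℝ (⊤ : ℕ∞) U) (hP : ContDiff ℝ (⊤ : ℕ∞) P) (hdiv : VectorCalculus.IsDivFree U)
    (heq : ∀ y : EuclideanSpace ℝ (Fin 3),
      α • (rotGen (U y) - fderiv ℝ U y (rotGen y)) + (1 / 2 : ℝ) • U y + (1 / 2 : ℝ) • fderiv ℝ U y y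
        - (Δ U) y + fderiv ℝ U y (U y) + gradient P y = 0)
    (hdec : ∀ y : EuclideanSpace ℝ (Fin 3), ‖U y‖ ≤ C₀ / (1 + ‖y‖))
    (hD1 : ∀ y : EuclideanSpace ℝ (Fin 3), ‖fderiv ℝ U y‖ ≤ K / (1 + ‖y‖) ^ 2) (hne : U ≠ 0) :
    ∃ y : EuclideanSpace ℝ (Fin 3), ‖curl U y‖ ^ 2 < ⟪curl U y, fderiv ℝ U y (curl U y)⟫ := by
  by_contra h
  push Not at h
  exact hne (stub_subcriticalStretchingSteady hU hP hdiv heq hdec hD1 h)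

/-- **Corollary A′ (lead c7) `rssProfileExists_supercritical_stretching` — every witness of stmt-16274 stretches supercritically.**
`RssProfileExists` yields a smooth nontrivial rotated Leray profile (`rssProfileExists_rotatedLerayProfile`, lead c5) with the
Type-I derivative decay (`rssData_derivativeDecay`, lead c6), hence (Corollary A) a point with `‖curl U‖² < ⟪curl U, DU (curl U)⟫`. -/
theorem rssProfileExists_supercritical_stretching
    (h : Summit.NavierStokesRegularity.NavierStokesRegularity.Theses.FilamentSkeletonRss.RssProfileExists) :
    ∃ (α C₀ K : ℝ) (U : EuclideanSpace ℝ (Fin 3) → EuclideanSpace ℝ (Fin 3)) (P : EuclideanSpace ℝ (Fin 3) → ℝ),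
      α ≠ 0 ∧ U ≠ 0 ∧ ContDiff ℝ (⊤ : ℕ∞) U ∧ ContDiff ℝ (⊤ : ℕ∞) P ∧ VectorCalculus.IsDivFree U ∧
      (∀ y : EuclideanSpace ℝ (Fin 3),
        α • (rotGen (U y) - fderiv ℝ U y (rotGen y)) + (1 / 2 : ℝ) • U y + (1 / 2 : ℝ) • fderiv ℝ U y y
          - (Δ U) y + fderiv ℝ U y (U y) + gradient P y = 0) ∧
      (∀ y : EuclideanSpace ℝ (Fin 3), ‖U y‖ ≤ C₀ / (1 + ‖y‖)) ∧
      (∀ y : EuclideanSpace ℝ (Fin 3), ‖fderiv ℝ U y‖ ≤ K / (1 + ‖y‖) ^ 2) ∧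
      ∃ y : EuclideanSpace ℝ (Fin 3), ‖curl U y‖ ^ 2 < ⟪curl U y, fderiv ℝ U y (curl U y)⟫ := by
  obtain ⟨α, C₀, U, Rot, u, hα, hRot, hU2, hU0, hu1, hrss, hmild, hmeas, hC⟩ := h
  obtain ⟨P, hU, hP, hdiv, heq, hdec, -, -, -⟩ := rssData_rotatedLerayProfile hRot hU2 hu1 hrss hmild hmeas hC
  obtain ⟨K, -, hK⟩ := rssData_derivativeDecay hRot hU2 hu1 hrss hmild hmeas hC
  exact ⟨α, C₀, K, U, P, hα, hU0, hU, hP, hdiv, heq, hdec, fun y => (hK y).1,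
    exists_supercritical_stretching_steady hU hP hdiv heq hdec (fun y => (hK y).1) hU0⟩

end StretchingNecessity

/-! ### The crux now decides the summit unconditionally (citations)

Since stmt-NavierStokesRegularity-11289 `RdssProfileTruncation` CLOSED (2026-08-17, `RdssProfileTruncation_proof`) and `ClayUniqueness`
is proved (`ClayUniqueness_holds`), the route's deciding theorem `closes` makes the crux ALONE refute the summit. -/

/-- `CorkscrewProfile → ¬NavierStokesRegularity`, unconditionally (route `closes` + the two proved companions). -/
example (h : Summit.NavierStokesRegularity.NavierStokesRegularity.Theses.CorkscrewDynamo.CorkscrewProfile) :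
    ¬ _root_.NavierStokesRegularity :=
  Summit.NavierStokesRegularity.NavierStokesRegularity.Theses.CorkscrewDynamo.closes h
    Summit.NavierStokesRegularity.NavierStokesRegularity.Theorems.RdssProfileTruncation_proof
    Summit.NavierStokesRegularity.NavierStokesRegularity.Theses.CorkscrewDynamo.ClayUniqueness_holds

/-- Contrapositive: the Millennium conjecture (positive side) refutes the crux. -/
example (h : _root_.NavierStokesRegularity) :
    ¬ Summit.NavierStokesRegularity.NavierStokesRegularity.Theses.CorkscrewDynamo.CorkscrewProfile := fun hc =>
  Summit.NavierStokesRegularity.NavierStokesRegularity.Theses.CorkscrewDynamo.closes hc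
    Summit.NavierStokesRegularity.NavierStokesRegularity.Theorems.RdssProfileTruncation_proof
    Summit.NavierStokesRegularity.NavierStokesRegularity.Theses.CorkscrewDynamo.ClayUniqueness_holds h

end Summit.NavierStokesRegularity.NavierStokesRegularity.Cruxes.CorkscrewProfile.Birth
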